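import Literature.Analysis.FluidPDE.LocalLerayInitialEnergy
import Literature.Analysis.FluidPDE.ForwardDSSLimitOriginal
import Literature.Analysis.FunctionSpaces.TestFunctionDensity
import Mathlib.MeasureTheory.Constructions.Polish.Basic
import HarnessLib

/-!
# Forward DSS solutions: continuity of the limit at `t = 0` — proof of `bradshawTsai2019_limitDatum`

Analysis/FluidPDE proofs file (no new definitions) **discharging the named fact**
`Literature.Analysis.FluidPDE.bradshawTsai2019_limitDatum` (`ForwardDSSCylinderLimitParts.lean`),
the second of the two DSS-free parts of the limit step of Bradshaw–Tsai, *Discretely self-similar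
solutions to the Navier–Stokes equations with data in `L²_loc` satisfying the local energy
inequality*, Analysis & PDE 12 (2019) = arXiv:1801.08060, §4.3 (p. 12): "For compact subsets
`K` of `B₁`, we automatically have `lim_{t→0⁺} ‖v − v₀‖_{L²(K)} = 0`". The printed argument is
Lemarié-Rieusset's (The Navier–Stokes problem in the 21st century, Prop. 14.1): weak continuity
at `t = 0` from the equations and `limsup_{t→0⁺} ∫|v(t)|²φ ≤ ∫|v₀|²φ` from the local energy
inequality up to `t = 0`, both *uniformly* along the approximating local Leray solutions, and
`‖v(t) − v₀‖² = ‖v(t)‖² − 2⟨v(t), v₀⟩ + ‖v₀‖²`.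

Main results:

* `bradshawTsai2019_limitDatum_holds : bradshawTsai2019_limitDatum` (**proved**);
* consequently `bradshawTsai2019_cylinderLimit_of_compactness`,
  `bradshawTsai2019_limit_4_3_of_compactness` and
  `bradshawTsai2019_dss_existence_of_prop_3_1_compactness`: the trust base of the limit fact
  `bradshawTsai2019_limit_4_3` is the single classical statement
  `bradshawTsai2019_cylinderCompactness` (interior compactness of suitable weak solutions on the
  unit cylinder), and that of Theorem 1.2 (`bradshawTsai2019_dss_existence`) is
  `{bradshawTsai2019_lemma_4_1, bradshawTsai2019_prop_3_1, bradshawTsai2019_cylinderCompactness}`.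

## The proof

Let `(v_k, π_k)` be local Leray solutions with data `w₀⁽ᵏ⁾ → v₀` in `L²(B₁)`, bounds
`esssup_{t<T} ∫_{B₁}|v_k|² ≤ C`, `∫∫_{(0,T)×B₁}|∇v_k|² ≤ C`, `∫∫_{(0,T)×B₁}|π_k|^{3/2} ≤ C`,
and `v_j → u` in `L²((0,T) × B₁)`. Fix a compact `K ⊆ B_{r'}`, `r' < 1`, a cut-off
`ψ ∈ C_c^∞(B_{r'})`, `0 ≤ ψ ≤ 1`, `ψ = 1` on `K`.

1. *Uniform integrability* (`LocalLerayInitialEnergy`): by the local `L^{10/3}` interpolation on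
   forward cylinders covering `(0,T₀) × B_{r'}`, `∫∫_{(0,T₀)×B_{r'}}|v_k|^{10/3} ≤ M` for all `k`.
2. *Energy from `t = 0`* (`IsLocalLeraySolution.ae_lintegral_sq_mul_le_datum_add`): for a.e.
   `t < T₀/2`, `∫|v_k(t)|²ψ ≤ ∫|w₀⁽ᵏ⁾|²ψ + Fl_k(t)` with the flux `Fl_k(t) ≤ ω(t) → 0`
   uniformly in `k` (`setLIntegral_energyFlux_le`, Hölder with the `L^{10/3}` bound).
3. *Weak continuity at `t = 0`* (`IsLocalLeraySolution.ae_pairing_eq_datum_add`): for every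
   test field `φ` and a.e. `t`, `|⟨v_k(t), φ⟩ − ⟨w₀⁽ᵏ⁾, φ⟩| ≤ ω'_φ(t) → 0` uniformly in `k`
   (`enorm_setIntegral_pairingFlux_le`).
4. *One step* (`lintegral_sq_sub_mul_le_of_energy_of_pairing`): for a slice `a = v_k(t)` and
   the datum `b = w₀⁽ᵏ⁾`, `∫|a − b|²ψ = ∫|a|²ψ − 2⟨a, ψb⟩ + ∫|b|²ψ ≤ 2⟨b − a, ψ b⟩ + Fl` and
   `⟨b − a, ψb⟩ = ⟨b − a, φ⟩ + ⟨b − a, ψb − φ⟩ ≤ ω' + ‖b − a‖₂ ‖ψ b − φ‖₂`, with test fields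
   `φ_m → ψ v₀` in `L²` (`FunctionSpaces.exists_isTestFunctionOn_eLpNorm_sub_le`).
5. *Limit* (`exists_ae_restrict_lintegral_sub_datum_le`): along a subsequence `v_j(t) → u(t)` in
   `L²(B₁)` for a.e. `t` (`exists_subseq_ae_tendsto_setLIntegral`); letting `j → ∞` at such `t`
   (`le_of_eventually_sqrt_le`) gives `∫_K|u(t) − v₀|² ≤ ε` for a.e. `t < δ(K, ε)`.
6. *Every `t`*: re-define the slices of `u` as `v₀` on the null set of bad times for the
   countably many `K_n = B̄_{1−1/(n+2)}`, `ε = 1/(p+1)` (`bradshawTsai2019_limitDatum_holds`).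

## References

* Z. Bradshaw, T.-P. Tsai, Analysis & PDE 12 (2019) 1943–1962 = arXiv:1801.08060, §4.3 (proof
  of Thm 1.2, p. 12) [BradshawTsai2019].
* P. G. Lemarié-Rieusset, *The Navier–Stokes Problem in the 21st Century*, CRC Press (2016),
  Prop. 14.1 [LemarieRieusset2016].
* L. Caffarelli, R. Kohn, L. Nirenberg, Comm. Pure Appl. Math. 35 (1982), §2 (2.5)
  [CaffarelliKohnNirenberg1982].
-/

noncomputable section

open MeasureTheory TopologicalSpace Set Function Filter Topology Metric
open scoped ENNReal NNReal RealInnerProductSpace Laplacian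

namespace Literature.Analysis.FluidPDE

namespace BradshawTsai2019

variable {E : Type*} [NormedAddCommGroup E] [InnerProductSpace ℝ E] [FiniteDimensional ℝ E]
  [MeasurableSpace E] [BorelSpace E]

/-! ### The one-step estimate -/

/-- **One step of the `L²(K)`-continuity estimate at `t = 0`.** Abstract form of the chain of
inequalities in the proof of `bradshawTsai2019_limitDatum` (Lemarié-Rieusset 2016, Prop. 14.1,
last step: "`‖u(t) − u₀‖² = ‖u(t)‖² − 2⟨u(t), u₀⟩ + ‖u₀‖²`, weak convergence and the `limsup` of
the energy"). For fields `a` (a time slice `v_k(t)`), `b` (the datum `w₀⁽ᵏ⁾`), `v₀` on `E`, a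
weight `0 ≤ ψ ≤ 1` and a test field `φ` both vanishing off a set `B` of finite measure: if
`∫ |a|²ψ ≤ ∫ |b|²ψ + Fl` (the local energy inequality from `t = 0`) and
`|⟨a, φ⟩ − ⟨b, φ⟩| ≤ W₀` (the weak continuity at `t = 0`), then
`∫ |a − v₀|² ψ ≤ 2 (2W₀ + 2(‖v₀‖ + ‖b − v₀‖ + C^{1/2})(‖b − v₀‖ + ‖ψ v₀ − φ‖) + Fl) + 2‖b − v₀‖²`,
norms in `L²(B)`, `∫_B |a|² ≤ C`. [cite: LemarieRieusset2016, Prop. 14.1] -/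
theorem lintegral_sq_sub_mul_le_of_energy_of_pairing
    {B : Set E} (hB : MeasurableSet B) (hBfin : volume B ≠ ⊤)
    {ψ : E → ℝ} (hψc : Continuous ψ) (hψ01 : ∀ x, ψ x ∈ Icc (0 : ℝ) 1)
    (hψB : ∀ x, x ∉ B → ψ x = 0)
    {a b v₀ φ : E → E} (ha : AEStronglyMeasurable a volume) (hb : AEStronglyMeasurable b volume)
    (hv₀ : AEStronglyMeasurable v₀ volume) (hφc : Continuous φ) (hφs : HasCompactSupport φ)
    (hφB : ∀ x, x ∉ B → φ x = 0)
    {C : ℝ≥0∞} (haC : ∫⁻ x in B, ‖a x‖ₑ ^ 2 ≤ C) (hC : C ≠ ⊤)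
    (hbv : ∫⁻ x in B, ‖b x - v₀ x‖ₑ ^ 2 ≠ ⊤) (hv₀B : ∫⁻ x in B, ‖v₀ x‖ₑ ^ 2 ≠ ⊤)
    {Fl : ℝ≥0∞} (hFl : Fl ≠ ⊤)
    (hLEI : ∫⁻ x, ‖a x‖ₑ ^ 2 * ENNReal.ofReal (ψ x) ≤
      (∫⁻ x, ‖b x‖ₑ ^ 2 * ENNReal.ofReal (ψ x)) + Fl)
    {W₀ : ℝ} (hW : |(∫ x, ⟪a x, φ x⟫) - ∫ x, ⟪b x, φ x⟫| ≤ W₀) :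
    ∫⁻ x, ‖a x - v₀ x‖ₑ ^ 2 * ENNReal.ofReal (ψ x) ≤
      2 * ENNReal.ofReal (2 * W₀ +
        2 * ((∫⁻ x in B, ‖v₀ x‖ₑ ^ 2) ^ (1 / 2 : ℝ) + (∫⁻ x in B, ‖b x - v₀ x‖ₑ ^ 2) ^ (1 / 2 : ℝ) +
          C ^ (1 / 2 : ℝ)).toReal *
        ((∫⁻ x in B, ‖b x - v₀ x‖ₑ ^ 2) ^ (1 / 2 : ℝ) +
          eLpNorm (fun x => ψ x • v₀ x - φ x) 2 (volume.restrict B)).toReal + Fl.toReal) +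
      2 * ∫⁻ x in B, ‖b x - v₀ x‖ₑ ^ 2 := by
  -- notation and elementary facts
  set μB : Measure E := (volume : Measure E).restrict B with hμB
  haveI : IsFiniteMeasure μB := ⟨by rw [hμB, Measure.restrict_apply_univ]; exact hBfin.lt_top⟩
  set N : ℝ≥0∞ := ∫⁻ x in B, ‖v₀ x‖ₑ ^ 2 with hN
  set eb : ℝ≥0∞ := ∫⁻ x in B, ‖b x - v₀ x‖ₑ ^ 2 with heb
  set D : ℝ≥0∞ := eLpNorm (fun x => ψ x • v₀ x - φ x) 2 μB with hD
  have hψ0 : ∀ x, 0 ≤ ψ x := fun x => (hψ01 x).1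
  have hψ1 : ∀ x, ψ x ≤ 1 := fun x => (hψ01 x).2
  have hψabs : ∀ x, ‖ψ x‖ ≤ 1 := fun x => by
    rw [Real.norm_eq_abs, abs_of_nonneg (hψ0 x)]; exact hψ1 x
  obtain ⟨Cφ, hCφ⟩ := hφc.bounded_above_of_compact_support hφs
  -- `L²(B)` memberships
  have hma : MemLp a 2 μB := memLp_two_restrict_of_lintegral_lt_top ha (haC.trans_lt hC.lt_top)
  have hmv₀ : MemLp v₀ 2 μB := memLp_two_restrict_of_lintegral_lt_top hv₀ hv₀B.lt_top
  have hmbv : MemLp (fun x => b x - v₀ x) 2 μB :=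
    memLp_two_restrict_of_lintegral_lt_top (hb.sub hv₀) hbv.lt_top
  have hmb : MemLp b 2 μB := by
    have := hmbv.add hmv₀
    have e : (fun x => b x - v₀ x) + v₀ = b := by funext x; simp
    rwa [e] at this
  have hmab : MemLp (fun x => a x - b x) 2 μB := hma.sub hmb
  have hmba : MemLp (fun x => b x - a x) 2 μB := hmb.sub hma
  have hmφ : MemLp φ 2 μB := by
    refine (memLp_const (Cφ : ℝ) |>.of_le (hφc.aestronglyMeasurable) ?_)
    exact Eventually.of_forall fun x => by rw [Real.norm_of_nonneg ((norm_nonneg _).trans (hCφ x))]; exact hCφ x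
  have hmψb : MemLp (fun x => ψ x • b x) 2 μB :=
    hmb.of_le ((hψc.aestronglyMeasurable.smul hb).restrict) (Eventually.of_forall fun x => by
      rw [norm_smul]; exact mul_le_of_le_one_left (norm_nonneg _) (hψabs x))
  have hmG : MemLp (fun x => ψ x • b x - φ x) 2 μB := hmψb.sub hmφ
  have hmψv : MemLp (fun x => ψ x • v₀ x) 2 μB :=
    hmv₀.of_le ((hψc.aestronglyMeasurable.smul hv₀).restrict) (Eventually.of_forall fun x => by
      rw [norm_smul]; exact mul_le_of_le_one_left (norm_nonneg _) (hψabs x))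
  have hmG0 : MemLp (fun x => ψ x • v₀ x - φ x) 2 μB := hmψv.sub hmφ
  -- squares are integrable on `B`; extension by zero to the whole space through the weight
  have hsq : ∀ {g : E → E}, MemLp g 2 μB → Integrable (fun x => ‖g x‖ ^ 2) μB := fun hg =>
    (memLp_two_iff_integrable_sq_norm hg.1).1 hg
  have hext : ∀ {g : E → ℝ}, Integrable g μB → Integrable (fun x => g x * ψ x) volume := by
    intro g hg
    have hgK : IntegrableOn (fun x => g x * ψ x) B volume :=
      hg.mul_bdd hψc.aestronglyMeasurable (Eventually.of_forall hψabs)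
    exact hgK.integrable_of_forall_notMem_eq_zero fun x hx => by rw [hψB x hx, mul_zero]
  have hrestr : ∀ g : E → ℝ, ∫ x, g x * ψ x = ∫ x in B, g x * ψ x := fun g =>
    (setIntegral_eq_integral_of_forall_compl_eq_zero fun x hx => by
      rw [hψB x hx, mul_zero]).symm
  -- the weighted squares as lower integrals
  have hlint : ∀ {g : E → E}, MemLp g 2 μB → AEStronglyMeasurable g volume →
      ∫⁻ x, ‖g x‖ₑ ^ 2 * ENNReal.ofReal (ψ x) = ENNReal.ofReal (∫ x, ‖g x‖ ^ 2 * ψ x) := by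
    intro g hg hgm
    rw [ofReal_integral_eq_lintegral_ofReal (hext (hsq hg))
      (Eventually.of_forall fun x => mul_nonneg (sq_nonneg _) (hψ0 x))]
    refine lintegral_congr fun x => ?_
    rw [ENNReal.ofReal_mul (sq_nonneg _), ENNReal.ofReal_pow (norm_nonneg _), ofReal_norm]
  -- Step 1: the energy inequality in real form
  set Ia : ℝ := ∫ x, ‖a x‖ ^ 2 * ψ x with hIa
  set Ib : ℝ := ∫ x, ‖b x‖ ^ 2 * ψ x with hIb
  have hIa0 : 0 ≤ Ia := integral_nonneg fun x => mul_nonneg (sq_nonneg _) (hψ0 x)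
  have hIb0 : 0 ≤ Ib := integral_nonneg fun x => mul_nonneg (sq_nonneg _) (hψ0 x)
  have hLEI' : Ia ≤ Ib + Fl.toReal := by
    rw [hlint hma ha, hlint hmb hb] at hLEI
    have hfin : ENNReal.ofReal Ib + Fl ≠ ⊤ := ENNReal.add_ne_top.2 ⟨ENNReal.ofReal_ne_top, hFl⟩
    have := (ENNReal.ofReal_le_iff_le_toReal hfin).1 hLEI
    rwa [ENNReal.toReal_add ENNReal.ofReal_ne_top hFl, ENNReal.toReal_ofReal hIb0] at this
  -- Step 2: `∫ |a - b|² ψ ≤ 2 ∫ ⟪b - a, ψ b⟫ + Fl`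
  have hinab : Integrable (fun x => ⟪a x, b x⟫) μB :=
    FunctionSpaces.integrable_inner_of_eLpNorm_two_lt_top hma.1 hmb.1 hma.2 hmb.2
  set J : ℝ := ∫ x, ‖a x - b x‖ ^ 2 * ψ x with hJ
  have hJ0 : 0 ≤ J := integral_nonneg fun x => mul_nonneg (sq_nonneg _) (hψ0 x)
  set P : ℝ := ∫ x, ⟪b x - a x, ψ x • b x⟫ with hP
  have hJle : J ≤ 2 * P + Fl.toReal := by
    have hJeq : J = Ia - 2 * (∫ x, ⟪a x, b x⟫ * ψ x) + Ib := by
      have h1 : ∫ x, ‖a x - b x‖ ^ 2 * ψ x =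
          ∫ x, (‖a x‖ ^ 2 * ψ x - 2 * (⟪a x, b x⟫ * ψ x) + ‖b x‖ ^ 2 * ψ x) :=
        integral_congr_ae (Eventually.of_forall fun x => by
          dsimp only; rw [norm_sub_sq_real]; ring)
      have iA : Integrable (fun x => ‖a x‖ ^ 2 * ψ x - 2 * (⟪a x, b x⟫ * ψ x)) volume :=
        (hext (hsq hma)).sub ((hext hinab).const_mul 2)
      rw [hJ, h1, integral_add iA (hext (hsq hmb)),
        integral_sub (hext (hsq hma)) ((hext hinab).const_mul 2), integral_const_mul]
    have hPeq : P = Ib - ∫ x, ⟪a x, b x⟫ * ψ x := by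
      rw [hP, hIb, ← integral_sub (hext (hsq hmb)) (hext hinab)]
      refine integral_congr_ae (Eventually.of_forall fun x => ?_)
      dsimp only
      rw [real_inner_smul_right, inner_sub_left, real_inner_self_eq_norm_sq]
      ring
    rw [hJeq, hPeq]
    linarith
  -- Step 3: `P ≤ W₀ + ‖b - a‖ (‖b - v₀‖ + D)`
  have hinφ : ∀ {g : E → E}, MemLp g 2 μB → Integrable (fun x => ⟪g x, φ x⟫) volume := by
    intro g hg
    have h1 : Integrable (fun x => ⟪g x, φ x⟫) μB :=
      FunctionSpaces.integrable_inner_of_eLpNorm_two_lt_top hg.1 hmφ.1 hg.2 hmφ.2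
    exact IntegrableOn.integrable_of_forall_notMem_eq_zero (μ := volume) (s := B) h1
      fun x hx => by rw [hφB x hx, inner_zero_right]
  have hGzero : ∀ x, x ∉ B → ψ x • b x - φ x = 0 := fun x hx => by
    rw [hψB x hx, hφB x hx, zero_smul, sub_zero]
  have hinG : Integrable (fun x => ⟪b x - a x, ψ x • b x - φ x⟫) volume := by
    have h1 : Integrable (fun x => ⟪b x - a x, ψ x • b x - φ x⟫) μB :=
      FunctionSpaces.integrable_inner_of_eLpNorm_two_lt_top hmba.1 hmG.1 hmba.2 hmG.2
    exact IntegrableOn.integrable_of_forall_notMem_eq_zero (μ := volume) (s := B) h1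
      fun x hx => by rw [hGzero x hx, inner_zero_right]
  have hPsplit : P = (∫ x, ⟪b x - a x, φ x⟫) + ∫ x, ⟪b x - a x, ψ x • b x - φ x⟫ := by
    rw [hP, ← integral_add (hinφ hmba) hinG]
    refine integral_congr_ae (Eventually.of_forall fun x => ?_)
    dsimp only
    rw [← inner_add_right, add_sub_cancel]
  have hP1 : ∫ x, ⟪b x - a x, φ x⟫ ≤ W₀ := by
    have e : ∫ x, ⟪b x - a x, φ x⟫ = (∫ x, ⟪b x, φ x⟫) - ∫ x, ⟪a x, φ x⟫ := by
      rw [← integral_sub (hinφ hmb) (hinφ hma)]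
      exact integral_congr_ae (Eventually.of_forall fun x => by dsimp only; rw [inner_sub_left])
    rw [e]
    calc (∫ x, ⟪b x, φ x⟫) - ∫ x, ⟪a x, φ x⟫ ≤ |(∫ x, ⟪b x, φ x⟫) - ∫ x, ⟪a x, φ x⟫| :=
          le_abs_self _
      _ = |(∫ x, ⟪a x, φ x⟫) - ∫ x, ⟪b x, φ x⟫| := abs_sub_comm _ _
      _ ≤ W₀ := hW
  -- the `L²(B)` norms as powers of lower integrals
  have hNa : eLpNorm a 2 μB ≤ C ^ (1 / 2 : ℝ) := by
    rw [eLpNorm_two_eq_rpow]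
    exact ENNReal.rpow_le_rpow haC (by norm_num)
  have hNv : eLpNorm v₀ 2 μB = N ^ (1 / 2 : ℝ) := eLpNorm_two_eq_rpow _
  have hNbv : eLpNorm (fun x => b x - v₀ x) 2 μB = eb ^ (1 / 2 : ℝ) :=
    eLpNorm_two_eq_rpow _
  have hba_le : eLpNorm (fun x => b x - a x) 2 μB ≤
      N ^ (1 / 2 : ℝ) + eb ^ (1 / 2 : ℝ) + C ^ (1 / 2 : ℝ) := by
    have e : (fun x => b x - a x) = (fun x => b x - v₀ x) + (fun x => v₀ x - a x) := by
      funext x; simp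
    rw [e]
    refine (eLpNorm_add_le hmbv.1 (hmv₀.1.sub hma.1) one_le_two).trans ?_
    rw [hNbv]
    have h2 : eLpNorm (fun x => v₀ x - a x) 2 μB ≤ N ^ (1 / 2 : ℝ) + C ^ (1 / 2 : ℝ) := by
      refine (eLpNorm_sub_le hmv₀.1 hma.1 one_le_two).trans ?_
      rw [hNv]
      exact add_le_add le_rfl hNa
    calc eb ^ (1 / 2 : ℝ) + eLpNorm (fun x => v₀ x - a x) 2 μB
        ≤ eb ^ (1 / 2 : ℝ) + (N ^ (1 / 2 : ℝ) + C ^ (1 / 2 : ℝ)) := add_le_add le_rfl h2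
      _ = N ^ (1 / 2 : ℝ) + eb ^ (1 / 2 : ℝ) + C ^ (1 / 2 : ℝ) := by ring
  have hG_le : eLpNorm (fun x => ψ x • b x - φ x) 2 μB ≤ eb ^ (1 / 2 : ℝ) + D := by
    have e : (fun x => ψ x • b x - φ x) =
        (fun x => ψ x • (b x - v₀ x)) + (fun x => ψ x • v₀ x - φ x) := by
      funext x; simp only [Pi.add_apply, smul_sub]; abel
    rw [e]
    have hm1 : AEStronglyMeasurable (fun x => ψ x • (b x - v₀ x)) μB :=
      (hψc.aestronglyMeasurable.smul (hb.sub hv₀)).restrict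
    refine (eLpNorm_add_le hm1 hmG0.1 one_le_two).trans ?_
    refine add_le_add ?_ le_rfl
    rw [← hNbv]
    refine eLpNorm_mono fun x => ?_
    rw [norm_smul]
    exact mul_le_of_le_one_left (norm_nonneg _) (hψabs x)
  have hfin1 : N ^ (1 / 2 : ℝ) + eb ^ (1 / 2 : ℝ) + C ^ (1 / 2 : ℝ) ≠ ⊤ :=
    ENNReal.add_ne_top.2 ⟨ENNReal.add_ne_top.2
      ⟨ENNReal.rpow_ne_top_of_nonneg (by norm_num) hv₀B,
       ENNReal.rpow_ne_top_of_nonneg (by norm_num) hbv⟩,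
      ENNReal.rpow_ne_top_of_nonneg (by norm_num) hC⟩
  have hfin2 : eb ^ (1 / 2 : ℝ) + D ≠ ⊤ :=
    ENNReal.add_ne_top.2 ⟨ENNReal.rpow_ne_top_of_nonneg (by norm_num) hbv, (show D ≠ ⊤ from hmG0.2.ne)⟩
  have hP2 : |∫ x, ⟪b x - a x, ψ x • b x - φ x⟫| ≤
      (N ^ (1 / 2 : ℝ) + eb ^ (1 / 2 : ℝ) + C ^ (1 / 2 : ℝ)).toReal * (eb ^ (1 / 2 : ℝ) + D).toReal := by
    have hrestr' : ∫ x, ⟪b x - a x, ψ x • b x - φ x⟫ = ∫ x, ⟪b x - a x, ψ x • b x - φ x⟫ ∂μB :=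
      (setIntegral_eq_integral_of_forall_compl_eq_zero fun x hx => by
        rw [hGzero x hx, inner_zero_right]).symm
    rw [hrestr', ← ENNReal.toReal_mul]
    have hCS := FunctionSpaces.enorm_integral_inner_le_eLpNorm_mul (π := μB) hmba.1 hmG.1
    have hle : ‖∫ x, ⟪b x - a x, ψ x • b x - φ x⟫ ∂μB‖ₑ ≤
        (N ^ (1 / 2 : ℝ) + eb ^ (1 / 2 : ℝ) + C ^ (1 / 2 : ℝ)) * (eb ^ (1 / 2 : ℝ) + D) :=
      hCS.trans (mul_le_mul' hba_le hG_le)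
    rw [show |∫ x, ⟪b x - a x, ψ x • b x - φ x⟫ ∂μB| =
        (‖∫ x, ⟪b x - a x, ψ x • b x - φ x⟫ ∂μB‖ₑ).toReal by
      rw [Real.enorm_eq_ofReal_abs, ENNReal.toReal_ofReal (abs_nonneg _)]]
    exact ENNReal.toReal_mono (ENNReal.mul_ne_top hfin1 hfin2) hle
  have hPle : P ≤ W₀ + (N ^ (1 / 2 : ℝ) + eb ^ (1 / 2 : ℝ) + C ^ (1 / 2 : ℝ)).toReal *
      (eb ^ (1 / 2 : ℝ) + D).toReal := by
    rw [hPsplit]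
    exact add_le_add hP1 ((le_abs_self _).trans hP2)
  -- Step 4: the weighted square of `a - v₀` (`‖x‖ₑ² ≤ 2‖x − y‖ₑ² + 2‖y‖ₑ²`)
  have hpar : ∀ x y : E, ‖x‖ₑ ^ 2 ≤ 2 * ‖x - y‖ₑ ^ 2 + 2 * ‖y‖ₑ ^ 2 := by
    intro x y
    have hr : ‖x‖ ^ 2 ≤ 2 * ‖x - y‖ ^ 2 + 2 * ‖y‖ ^ 2 := by
      have h1 : ‖x‖ ≤ ‖x - y‖ + ‖y‖ := norm_le_norm_sub_add x y
      nlinarith [norm_nonneg x, norm_nonneg (x - y), norm_nonneg y, sq_nonneg (‖x - y‖ - ‖y‖)]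
    calc ‖x‖ₑ ^ 2 = ENNReal.ofReal (‖x‖ ^ 2) := by
          rw [ENNReal.ofReal_pow (norm_nonneg _), ofReal_norm]
      _ ≤ ENNReal.ofReal (2 * ‖x - y‖ ^ 2 + 2 * ‖y‖ ^ 2) := ENNReal.ofReal_le_ofReal hr
      _ = 2 * ‖x - y‖ₑ ^ 2 + 2 * ‖y‖ₑ ^ 2 := by
          rw [ENNReal.ofReal_add (by positivity) (by positivity), ENNReal.ofReal_mul zero_le_two,
            ENNReal.ofReal_mul zero_le_two, ENNReal.ofReal_pow (norm_nonneg _),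
            ENNReal.ofReal_pow (norm_nonneg _), ofReal_norm, ofReal_norm, ENNReal.ofReal_ofNat]
  set S : ℝ := 2 * W₀ + 2 * (N ^ (1 / 2 : ℝ) + eb ^ (1 / 2 : ℝ) + C ^ (1 / 2 : ℝ)).toReal *
      (eb ^ (1 / 2 : ℝ) + D).toReal + Fl.toReal with hS
  have hJS : J ≤ S := by rw [hS]; nlinarith [hJle, hPle]
  have hmeas1 : AEMeasurable (fun x => 2 * (‖a x - b x‖ₑ ^ 2 * ENNReal.ofReal (ψ x))) volume :=
    ((((ha.sub hb).enorm.pow_const 2).mul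
      (hψc.measurable.ennreal_ofReal.aemeasurable))).const_mul 2
  calc ∫⁻ x, ‖a x - v₀ x‖ₑ ^ 2 * ENNReal.ofReal (ψ x)
      ≤ ∫⁻ x, (2 * (‖a x - b x‖ₑ ^ 2 * ENNReal.ofReal (ψ x)) +
          2 * (‖b x - v₀ x‖ₑ ^ 2 * ENNReal.ofReal (ψ x))) := by
        refine lintegral_mono fun x => ?_
        have := hpar (a x - v₀ x) (b x - v₀ x)
        rw [sub_sub_sub_cancel_right] at this
        calc ‖a x - v₀ x‖ₑ ^ 2 * ENNReal.ofReal (ψ x)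
            ≤ (2 * ‖a x - b x‖ₑ ^ 2 + 2 * ‖b x - v₀ x‖ₑ ^ 2) * ENNReal.ofReal (ψ x) := by
              gcongr
          _ = _ := by ring
    _ = (2 * ∫⁻ x, ‖a x - b x‖ₑ ^ 2 * ENNReal.ofReal (ψ x)) +
          2 * ∫⁻ x, ‖b x - v₀ x‖ₑ ^ 2 * ENNReal.ofReal (ψ x) := by
        rw [lintegral_add_left' hmeas1, lintegral_const_mul' _ _ ENNReal.ofNat_ne_top,
          lintegral_const_mul' _ _ ENNReal.ofNat_ne_top]
    _ ≤ 2 * ENNReal.ofReal S + 2 * eb := by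
        refine add_le_add ?_ ?_
        · rw [hlint hmab (ha.sub hb)]
          gcongr
        · apply mul_le_mul_right
          rw [heb, ← lintegral_indicator hB]
          refine lintegral_mono fun x => ?_
          by_cases hx : x ∈ B
          · rw [indicator_of_mem hx]
            calc ‖b x - v₀ x‖ₑ ^ 2 * ENNReal.ofReal (ψ x) ≤ ‖b x - v₀ x‖ₑ ^ 2 * 1 := by
                  gcongr
                  rw [← ENNReal.ofReal_one]
                  exact ENNReal.ofReal_le_ofReal (hψ1 x)
              _ = ‖b x - v₀ x‖ₑ ^ 2 := mul_one _
          · rw [indicator_of_notMem hx, hψB x hx, ENNReal.ofReal_zero, mul_zero]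


/-! ### Flux bounds on initial layers -/

/-- **Energy on an initial layer**: if `∫_{B₁} |v(t)|² ≤ C` for a.e. `t ∈ (0,T)` then
`∫∫_{(0,s)×B_r} |v|² ≤ C s` for `s ≤ T`, `r ≤ 1` (Tonelli). [folklore] -/
theorem setLIntegral_layer_sq_le {v : ℝ → E → E} {T : ℝ} {C : ℝ≥0∞}
    (hE : ∀ᵐ t ∂(volume.restrict (Ioo 0 T)), ∫⁻ x in ball (0 : E) 1, ‖v t x‖ₑ ^ 2 ≤ C)
    {s r : ℝ} (hsT : s ≤ T) (hr : r ≤ 1) :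
    ∫⁻ z in Ioo 0 s ×ˢ ball (0 : E) r, ‖v z.1 z.2‖ₑ ^ 2 ≤ C * ENNReal.ofReal s := by
  calc ∫⁻ z in Ioo 0 s ×ˢ ball (0 : E) r, ‖v z.1 z.2‖ₑ ^ 2
      ≤ ∫⁻ z in Ioo 0 s ×ˢ ball (0 : E) 1, ‖v z.1 z.2‖ₑ ^ 2 :=
        lintegral_mono_set (prod_mono Subset.rfl (ball_subset_ball hr))
    _ ≤ ∫⁻ t in Ioo 0 s, ∫⁻ x in ball (0 : E) 1, ‖v t x‖ₑ ^ 2 := by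
        rw [Measure.volume_eq_prod, ← Measure.prod_restrict]
        exact lintegral_prod_le _
    _ ≤ ∫⁻ t in Ioo 0 s, C := by
        refine lintegral_mono_ae ?_
        exact ae_restrict_of_ae_restrict_of_subset (Ioo_subset_Ioo_right hsT) hE
    _ = C * ENNReal.ofReal s := by
        rw [lintegral_const, Measure.restrict_apply_univ, Real.volume_Ioo, sub_zero]

omit [NormedAddCommGroup E] [InnerProductSpace ℝ E] [FiniteDimensional ℝ E] [MeasurableSpace E]
  [BorelSpace E] in
/-- Hölder with the constant function: `∫⁻_S f ≤ (∫⁻_S f^p)^{1/p} (μ S)^{1/q}` for conjugate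
`p, q`. [folklore] -/
theorem setLIntegral_le_rpow_mul_measure_rpow {α : Type*} [MeasurableSpace α] (μ : Measure α)
    {S : Set α} {f : α → ℝ≥0∞} (hf : AEMeasurable f (μ.restrict S)) {p q : ℝ}
    (hpq : p.HolderConjugate q) :
    ∫⁻ x in S, f x ∂μ ≤ (∫⁻ x in S, f x ^ p ∂μ) ^ (1 / p) * (μ S) ^ (1 / q) := by
  have key := ENNReal.lintegral_mul_le_Lp_mul_Lq (μ.restrict S) hpq hf aemeasurable_const
    (g := fun _ => (1 : ℝ≥0∞))
  simp only [Pi.mul_apply, mul_one, ENNReal.one_rpow, lintegral_const,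
    Measure.restrict_apply_univ, one_mul] at key
  exact key

/-- **The flux of the local energy inequality on an initial layer is small uniformly.** For
measurable `v`, `π` on `(0,T₀) × B_r` (`r ≤ 1`, `T₀ ≤ T`) with `esssup_{t<T} ∫_{B₁}|v|² ≤ C`,
`∫∫_{(0,T)×B₁}|π|^{3/2} ≤ C` and `∫∫_{(0,T₀)×B_r}|v|^{10/3} ≤ M`, and a weight `ψ` with
`|Δψ|, |∇ψ| ≤ D`: for `0 < s ≤ T₀`,
`∫∫_{(0,s)×B_r} | |v|²Δψ + (|v|²+2π) v·∇ψ | ≤ D (C s + M^{9/10} V^{1/10} + 2 C^{2/3} (M^{9/10} V^{1/10})^{1/3})`,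
`V = |(0,s) × B_r|` (Hölder; Lemarié-Rieusset 2016, proof of Prop. 14.1: the right-hand side of
the local energy inequality tends to `0` with the height of the layer). [cite: LemarieRieusset2016, Prop. 14.1] -/
theorem setLIntegral_energyFlux_le {v : ℝ → E → E} {π : ℝ → E → ℝ} {T T₀ r : ℝ}
    (hvm : AEStronglyMeasurable (uncurry v) (volume.restrict (Ioo 0 T₀ ×ˢ ball (0 : E) r)))
    (hπm : AEStronglyMeasurable (uncurry π) (volume.restrict (Ioo 0 T₀ ×ˢ ball (0 : E) r)))
    (hT₀T : T₀ ≤ T) (hr : r ≤ 1) {C : ℝ≥0∞}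
    (hE : ∀ᵐ t ∂(volume.restrict (Ioo 0 T)), ∫⁻ x in ball (0 : E) 1, ‖v t x‖ₑ ^ 2 ≤ C)
    (hP : ∫⁻ z in Ioo 0 T ×ˢ ball (0 : E) 1, ‖π z.1 z.2‖ₑ ^ (3 / 2 : ℝ) ≤ C)
    {M : ℝ≥0∞} (hM : ∫⁻ z in Ioo 0 T₀ ×ˢ ball (0 : E) r, ‖v z.1 z.2‖ₑ ^ (10 / 3 : ℝ) ≤ M)
    {ψ : E → ℝ} {D : ℝ} (hΔ : ∀ x, |Δ ψ x| ≤ D) (hgrad : ∀ x, ‖gradient ψ x‖ ≤ D)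
    {s : ℝ} (hs : s ∈ Ioc 0 T₀) :
    ∫⁻ z in Ioo 0 s ×ˢ ball (0 : E) r,
        ‖‖v z.1 z.2‖ ^ 2 * Δ ψ z.2 + (‖v z.1 z.2‖ ^ 2 + 2 * π z.1 z.2) * ⟪v z.1 z.2, gradient ψ z.2⟫‖ₑ ≤
      ENNReal.ofReal D * (C * ENNReal.ofReal s +
        M ^ (9 / 10 : ℝ) * (volume (Ioo 0 s ×ˢ ball (0 : E) r)) ^ (1 / 10 : ℝ) +
        2 * (C ^ (2 / 3 : ℝ) * (M ^ (9 / 10 : ℝ) *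
          (volume (Ioo 0 s ×ˢ ball (0 : E) r)) ^ (1 / 10 : ℝ)) ^ (1 / 3 : ℝ))) := by
  set S : Set (ℝ × E) := Ioo 0 s ×ˢ ball (0 : E) r with hS
  have hSsub : S ⊆ Ioo 0 T₀ ×ˢ ball (0 : E) r := prod_mono (Ioo_subset_Ioo_right hs.2) Subset.rfl
  have hSsub1 : S ⊆ Ioo 0 T ×ˢ ball (0 : E) 1 :=
    prod_mono (Ioo_subset_Ioo_right (hs.2.trans hT₀T)) (ball_subset_ball hr)
  have hD0 : 0 ≤ D := (abs_nonneg _).trans (hΔ 0)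
  -- measurability on `S`
  have hvS : AEStronglyMeasurable (uncurry v) (volume.restrict S) :=
    hvm.mono_measure (Measure.restrict_mono hSsub le_rfl)
  have hπS : AEStronglyMeasurable (uncurry π) (volume.restrict S) :=
    hπm.mono_measure (Measure.restrict_mono hSsub le_rfl)
  have mv : AEMeasurable (fun z : ℝ × E => ‖v z.1 z.2‖ₑ) (volume.restrict S) := hvS.enorm
  have mπ : AEMeasurable (fun z : ℝ × E => ‖π z.1 z.2‖ₑ) (volume.restrict S) := hπS.enorm
  -- the pointwise bound
  have hpt : ∀ z : ℝ × E,
      ‖‖v z.1 z.2‖ ^ 2 * Δ ψ z.2 + (‖v z.1 z.2‖ ^ 2 + 2 * π z.1 z.2) * ⟪v z.1 z.2, gradient ψ z.2⟫‖ₑ ≤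
        ENNReal.ofReal D * (‖v z.1 z.2‖ₑ ^ 2 + ‖v z.1 z.2‖ₑ ^ (3 : ℝ) +
          2 * (‖π z.1 z.2‖ₑ * ‖v z.1 z.2‖ₑ)) := by
    intro z
    set a := ‖v z.1 z.2‖ with ha
    have ha0 : 0 ≤ a := norm_nonneg _
    have hreal : |a ^ 2 * Δ ψ z.2 + (a ^ 2 + 2 * π z.1 z.2) * ⟪v z.1 z.2, gradient ψ z.2⟫| ≤
        D * (a ^ 2 + a ^ 3 + 2 * (|π z.1 z.2| * a)) := by
      have h1 : |a ^ 2 * Δ ψ z.2| ≤ D * a ^ 2 := by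
        rw [abs_mul, abs_of_nonneg (sq_nonneg _), mul_comm]
        exact mul_le_mul_of_nonneg_right (hΔ _) (sq_nonneg _)
      have h2 : |⟪v z.1 z.2, gradient ψ z.2⟫| ≤ a * D :=
        (abs_real_inner_le_norm _ _).trans (mul_le_mul_of_nonneg_left (hgrad _) ha0)
      have h3 : |a ^ 2 + 2 * π z.1 z.2| ≤ a ^ 2 + 2 * |π z.1 z.2| :=
        (abs_add_le _ _).trans (by rw [abs_of_nonneg (sq_nonneg _), abs_mul, abs_two])
      calc |a ^ 2 * Δ ψ z.2 + (a ^ 2 + 2 * π z.1 z.2) * ⟪v z.1 z.2, gradient ψ z.2⟫|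
          ≤ |a ^ 2 * Δ ψ z.2| + |a ^ 2 + 2 * π z.1 z.2| * |⟪v z.1 z.2, gradient ψ z.2⟫| := by
            refine (abs_add_le _ _).trans ?_
            rw [abs_mul (a ^ 2 + 2 * π z.1 z.2)]
        _ ≤ D * a ^ 2 + (a ^ 2 + 2 * |π z.1 z.2|) * (a * D) := by gcongr
        _ = D * (a ^ 2 + a ^ 3 + 2 * (|π z.1 z.2| * a)) := by ring
    calc ‖a ^ 2 * Δ ψ z.2 + (a ^ 2 + 2 * π z.1 z.2) * ⟪v z.1 z.2, gradient ψ z.2⟫‖ₑ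
        = ENNReal.ofReal |a ^ 2 * Δ ψ z.2 + (a ^ 2 + 2 * π z.1 z.2) * ⟪v z.1 z.2, gradient ψ z.2⟫| :=
          Real.enorm_eq_ofReal_abs _
      _ ≤ ENNReal.ofReal (D * (a ^ 2 + a ^ 3 + 2 * (|π z.1 z.2| * a))) :=
          ENNReal.ofReal_le_ofReal hreal
      _ = ENNReal.ofReal D * (‖v z.1 z.2‖ₑ ^ 2 + ‖v z.1 z.2‖ₑ ^ (3 : ℝ) +
          2 * (‖π z.1 z.2‖ₑ * ‖v z.1 z.2‖ₑ)) := by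
          rw [ENNReal.ofReal_mul hD0, ENNReal.ofReal_add (by positivity) (by positivity),
            ENNReal.ofReal_add (by positivity) (by positivity), ENNReal.ofReal_mul zero_le_two,
            ENNReal.ofReal_ofNat, ENNReal.ofReal_mul (abs_nonneg _), ha,
            ENNReal.ofReal_pow (norm_nonneg _), ofReal_norm,
            show (3 : ℝ) = ((3 : ℕ) : ℝ) by norm_num, ENNReal.rpow_natCast,
            ENNReal.ofReal_pow (norm_nonneg _), ofReal_norm, ← Real.enorm_eq_ofReal_abs]
  -- integrate the pointwise bound
  have hint : ∫⁻ z in S, ‖‖v z.1 z.2‖ ^ 2 * Δ ψ z.2 +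
      (‖v z.1 z.2‖ ^ 2 + 2 * π z.1 z.2) * ⟪v z.1 z.2, gradient ψ z.2⟫‖ₑ ≤
      ENNReal.ofReal D * ((∫⁻ z in S, ‖v z.1 z.2‖ₑ ^ 2) + (∫⁻ z in S, ‖v z.1 z.2‖ₑ ^ (3 : ℝ)) +
        2 * ∫⁻ z in S, ‖π z.1 z.2‖ₑ * ‖v z.1 z.2‖ₑ) := by
    calc ∫⁻ z in S, ‖‖v z.1 z.2‖ ^ 2 * Δ ψ z.2 +
          (‖v z.1 z.2‖ ^ 2 + 2 * π z.1 z.2) * ⟪v z.1 z.2, gradient ψ z.2⟫‖ₑ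
        ≤ ∫⁻ z in S, ENNReal.ofReal D * (‖v z.1 z.2‖ₑ ^ 2 + ‖v z.1 z.2‖ₑ ^ (3 : ℝ) +
            2 * (‖π z.1 z.2‖ₑ * ‖v z.1 z.2‖ₑ)) := lintegral_mono hpt
      _ = ENNReal.ofReal D * ((∫⁻ z in S, ‖v z.1 z.2‖ₑ ^ 2) + (∫⁻ z in S, ‖v z.1 z.2‖ₑ ^ (3 : ℝ)) +
            2 * ∫⁻ z in S, ‖π z.1 z.2‖ₑ * ‖v z.1 z.2‖ₑ) := by
          have mAB : AEMeasurable (fun z : ℝ × E => ‖v z.1 z.2‖ₑ ^ 2 + ‖v z.1 z.2‖ₑ ^ (3 : ℝ))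
              (volume.restrict S) := (mv.pow_const (2 : ℕ)).add (mv.pow_const (3 : ℝ))
          rw [lintegral_const_mul' _ _ ENNReal.ofReal_ne_top, lintegral_add_left' mAB,
            lintegral_add_left' (mv.pow_const (2 : ℕ)),
            lintegral_const_mul' _ _ ENNReal.ofNat_ne_top]
  -- the three pieces
  have h1 : ∫⁻ z in S, ‖v z.1 z.2‖ₑ ^ 2 ≤ C * ENNReal.ofReal s :=
    setLIntegral_layer_sq_le hE (hs.2.trans hT₀T) hr
  have h2 : ∫⁻ z in S, ‖v z.1 z.2‖ₑ ^ (3 : ℝ) ≤ M ^ (9 / 10 : ℝ) * (volume S) ^ (1 / 10 : ℝ) := by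
    have hpq : (10 / 9 : ℝ).HolderConjugate 10 :=
      Real.holderConjugate_iff.2 ⟨by norm_num, by norm_num⟩
    have key := setLIntegral_le_rpow_mul_measure_rpow volume (mv.pow_const (3 : ℝ)) hpq
    refine key.trans (mul_le_mul' ?_ le_rfl)
    have e : ∀ z : ℝ × E, (‖v z.1 z.2‖ₑ ^ (3 : ℝ)) ^ (10 / 9 : ℝ) = ‖v z.1 z.2‖ₑ ^ (10 / 3 : ℝ) := by
      intro z
      rw [← ENNReal.rpow_mul]
      norm_num
    simp_rw [e]
    rw [show (1 / (10 / 9) : ℝ) = 9 / 10 by norm_num]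
    exact ENNReal.rpow_le_rpow ((lintegral_mono_set hSsub).trans hM) (by norm_num)
  have h3 : ∫⁻ z in S, ‖π z.1 z.2‖ₑ * ‖v z.1 z.2‖ₑ ≤
      C ^ (2 / 3 : ℝ) * (M ^ (9 / 10 : ℝ) * (volume S) ^ (1 / 10 : ℝ)) ^ (1 / 3 : ℝ) := by
    have hpq : (3 / 2 : ℝ).HolderConjugate 3 := Real.holderConjugate_iff.2 ⟨by norm_num, by norm_num⟩
    have key := ENNReal.lintegral_mul_le_Lp_mul_Lq (volume.restrict S) hpq mπ mv
    refine key.trans (mul_le_mul' ?_ ?_)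
    · rw [show (1 / (3 / 2) : ℝ) = 2 / 3 by norm_num]
      exact ENNReal.rpow_le_rpow ((lintegral_mono_set hSsub1).trans hP) (by norm_num)
    · exact ENNReal.rpow_le_rpow h2 (by norm_num)
  refine hint.trans (mul_le_mul' le_rfl ?_)
  exact add_le_add (add_le_add h1 h2) (mul_le_mul' le_rfl h3)

/-- **The flux of the weak form on an initial layer is small uniformly.** For measurable `v`,
`π` on `(0,T₀) × B₁` (`T₀ ≤ T`) with `esssup_{t<T} ∫_{B₁}|v|² ≤ C` and
`∫∫_{(0,T)×B₁}|π|^{3/2} ≤ C`, and a field `φ` supported in `B₁` with `|∇φ|, |Δφ|, |div φ| ≤ D`: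
for `0 < t ≤ T₀`,
`|∫₀ᵗ∫ (⟪v,(v·∇)φ⟫ + ⟪v,Δφ⟫ + π div φ)| ≤ D (C t + (C t)^{1/2} V^{1/2} + C^{2/3} V^{1/3})`,
`V = |(0,t) × B₁|` (Hölder; Lemarié-Rieusset 2016, proof of Prop. 14.1: weak equicontinuity at
`t = 0`). [cite: LemarieRieusset2016, Prop. 14.1] -/
theorem enorm_setIntegral_pairingFlux_le {v : ℝ → E → E} {π : ℝ → E → ℝ} {T T₀ : ℝ}
    (hvm : AEStronglyMeasurable (uncurry v) (volume.restrict (Ioo 0 T₀ ×ˢ ball (0 : E) 1)))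
    (hπm : AEStronglyMeasurable (uncurry π) (volume.restrict (Ioo 0 T₀ ×ˢ ball (0 : E) 1)))
    (hT₀T : T₀ ≤ T) {C : ℝ≥0∞}
    (hE : ∀ᵐ t ∂(volume.restrict (Ioo 0 T)), ∫⁻ x in ball (0 : E) 1, ‖v t x‖ₑ ^ 2 ≤ C)
    (hP : ∫⁻ z in Ioo 0 T ×ˢ ball (0 : E) 1, ‖π z.1 z.2‖ₑ ^ (3 / 2 : ℝ) ≤ C)
    {φ : E → E} {D : ℝ} (hD1 : ∀ x, ‖fderiv ℝ φ x‖ ≤ D) (hD2 : ∀ x, ‖Δ φ x‖ ≤ D)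
    (hD3 : ∀ x, |VectorCalculus.divergence φ x| ≤ D) (hφ1 : tsupport φ ⊆ ball (0 : E) 1)
    {t : ℝ} (ht : t ∈ Ioc 0 T₀) :
    ‖∫ s in Ioo 0 t, ∫ x, (⟪v s x, convect (v s) φ x⟫ + ⟪v s x, Δ φ x⟫ +
        π s x * VectorCalculus.divergence φ x)‖ₑ ≤
      ENNReal.ofReal D * (C * ENNReal.ofReal t +
        (C * ENNReal.ofReal t) ^ (1 / 2 : ℝ) * (volume (Ioo 0 t ×ˢ ball (0 : E) 1)) ^ (1 / 2 : ℝ) +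
        C ^ (2 / 3 : ℝ) * (volume (Ioo 0 t ×ˢ ball (0 : E) 1)) ^ (1 / 3 : ℝ)) := by
  set S : Set (ℝ × E) := Ioo 0 t ×ˢ ball (0 : E) 1 with hS
  have hSsub : S ⊆ Ioo 0 T₀ ×ˢ ball (0 : E) 1 := prod_mono (Ioo_subset_Ioo_right ht.2) Subset.rfl
  have hSsubT : S ⊆ Ioo 0 T ×ˢ ball (0 : E) 1 :=
    prod_mono (Ioo_subset_Ioo_right (ht.2.trans hT₀T)) Subset.rfl
  have hD0 : 0 ≤ D := (norm_nonneg _).trans (hD1 0)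
  -- measurability on `S`
  have hvS : AEStronglyMeasurable (uncurry v) (volume.restrict S) :=
    hvm.mono_measure (Measure.restrict_mono hSsub le_rfl)
  have hπS : AEStronglyMeasurable (uncurry π) (volume.restrict S) :=
    hπm.mono_measure (Measure.restrict_mono hSsub le_rfl)
  have mv : AEMeasurable (fun z : ℝ × E => ‖v z.1 z.2‖ₑ) (volume.restrict S) := hvS.enorm
  have mπ : AEMeasurable (fun z : ℝ × E => ‖π z.1 z.2‖ₑ) (volume.restrict S) := hπS.enorm
  -- the integrand, its pointwise bound and its support
  set I : ℝ → E → ℝ := fun s x => ⟪v s x, convect (v s) φ x⟫ + ⟪v s x, Δ φ x⟫ +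
    π s x * VectorCalculus.divergence φ x with hI
  set g : ℝ × E → ℝ≥0∞ := fun z => ‖v z.1 z.2‖ₑ ^ 2 + ‖v z.1 z.2‖ₑ + ‖π z.1 z.2‖ₑ with hg
  have mg : AEMeasurable g (volume.restrict S) := ((mv.pow_const (2 : ℕ)).add mv).add mπ
  have hpt : ∀ s x, ‖I s x‖ₑ ≤ ENNReal.ofReal D * g (s, x) := by
    intro s x
    set a := ‖v s x‖ with ha
    have ha0 : 0 ≤ a := norm_nonneg _
    have hreal : |I s x| ≤ D * (a ^ 2 + a + |π s x|) := by
      have h1 : |⟪v s x, convect (v s) φ x⟫| ≤ D * a ^ 2 := by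
        refine (abs_real_inner_le_norm _ _).trans ?_
        rw [← ha]
        calc a * ‖convect (v s) φ x‖ ≤ a * (D * a) := by
              refine mul_le_mul_of_nonneg_left ?_ ha0
              calc ‖convect (v s) φ x‖ = ‖fderiv ℝ φ x (v s x)‖ := rfl
                _ ≤ ‖fderiv ℝ φ x‖ * ‖v s x‖ := ContinuousLinearMap.le_opNorm _ _
                _ ≤ D * a := by rw [← ha]; exact mul_le_mul_of_nonneg_right (hD1 x) ha0
          _ = D * a ^ 2 := by ring
      have h2 : |⟪v s x, Δ φ x⟫| ≤ D * a := by
        refine (abs_real_inner_le_norm _ _).trans ?_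
        rw [← ha, mul_comm]
        exact mul_le_mul_of_nonneg_right (hD2 x) ha0
      have h3 : |π s x * VectorCalculus.divergence φ x| ≤ D * |π s x| := by
        rw [abs_mul, mul_comm]
        exact mul_le_mul_of_nonneg_right (hD3 x) (abs_nonneg _)
      calc |I s x| ≤ |⟪v s x, convect (v s) φ x⟫ + ⟪v s x, Δ φ x⟫| +
            |π s x * VectorCalculus.divergence φ x| := abs_add_le _ _
        _ ≤ |⟪v s x, convect (v s) φ x⟫| + |⟪v s x, Δ φ x⟫| +
            |π s x * VectorCalculus.divergence φ x| := by gcongr; exact abs_add_le _ _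
        _ ≤ D * a ^ 2 + D * a + D * |π s x| := by gcongr
        _ = D * (a ^ 2 + a + |π s x|) := by ring
    calc ‖I s x‖ₑ = ENNReal.ofReal |I s x| := Real.enorm_eq_ofReal_abs _
      _ ≤ ENNReal.ofReal (D * (a ^ 2 + a + |π s x|)) := ENNReal.ofReal_le_ofReal hreal
      _ = ENNReal.ofReal D * g (s, x) := by
          rw [hg, ENNReal.ofReal_mul hD0, ENNReal.ofReal_add (by positivity) (abs_nonneg _),
            ENNReal.ofReal_add (by positivity) ha0, ha, ENNReal.ofReal_pow (norm_nonneg _),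
            ofReal_norm, ← Real.enorm_eq_ofReal_abs]
  have hzero : ∀ s x, x ∉ ball (0 : E) 1 → I s x = 0 := by
    intro s x hx
    have hx' : x ∉ tsupport φ := fun h' => hx (hφ1 h')
    have hf : fderiv ℝ φ x = 0 := fderiv_of_notMem_tsupport ℝ hx'
    have hL : Δ φ x = 0 := laplacian_eq_zero_of_notMem_tsupport hx'
    simp [hI, convect, hf, hL, VectorCalculus.divergence]
  -- from the Bochner integral to the space–time lower integral
  have hstep1 : ‖∫ s in Ioo 0 t, ∫ x, I s x‖ₑ ≤ ∫⁻ s in Ioo 0 t, ∫⁻ x in ball (0 : E) 1, ‖I s x‖ₑ := by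
    refine (enorm_integral_le_lintegral_enorm _).trans (lintegral_mono fun s => ?_)
    refine (enorm_integral_le_lintegral_enorm _).trans (le_of_eq ?_)
    rw [← lintegral_indicator measurableSet_ball]
    refine lintegral_congr fun x => ?_
    by_cases hx : x ∈ ball (0 : E) 1
    · rw [indicator_of_mem hx]
    · rw [indicator_of_notMem hx, hzero s x hx, enorm_zero]
  have hstep2 : ∫⁻ s in Ioo 0 t, ∫⁻ x in ball (0 : E) 1, ‖I s x‖ₑ ≤
      ∫⁻ s in Ioo 0 t, ∫⁻ x in ball (0 : E) 1, ENNReal.ofReal D * g (s, x) :=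
    lintegral_mono fun s => lintegral_mono fun x => hpt s x
  have hstep3 : ∫⁻ s in Ioo 0 t, ∫⁻ x in ball (0 : E) 1, ENNReal.ofReal D * g (s, x) =
      ENNReal.ofReal D * ((∫⁻ z in S, ‖v z.1 z.2‖ₑ ^ 2) + (∫⁻ z in S, ‖v z.1 z.2‖ₑ) +
        ∫⁻ z in S, ‖π z.1 z.2‖ₑ) := by
    have hmeas : AEMeasurable (fun z : ℝ × E => ENNReal.ofReal D * g z)
        (((volume : Measure ℝ).prod (volume : Measure E)).restrict S) := by
      rw [← Measure.volume_eq_prod]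
      exact mg.const_mul _
    have key := setLIntegral_prod (μ := (volume : Measure ℝ)) (ν := (volume : Measure E))
      (fun z : ℝ × E => ENNReal.ofReal D * g z) hmeas
    rw [← Measure.volume_eq_prod] at key
    have m2 : AEMeasurable (fun z : ℝ × E => ‖v z.1 z.2‖ₑ ^ 2 + ‖v z.1 z.2‖ₑ) (volume.restrict S) :=
      (mv.pow_const (2 : ℕ)).add mv
    rw [← key, lintegral_const_mul' _ _ ENNReal.ofReal_ne_top]
    congr 1
    simp only [hg]
    rw [lintegral_add_left' m2, lintegral_add_left' (mv.pow_const (2 : ℕ))]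
  -- the three pieces
  have h1 : ∫⁻ z in S, ‖v z.1 z.2‖ₑ ^ 2 ≤ C * ENNReal.ofReal t :=
    setLIntegral_layer_sq_le hE (ht.2.trans hT₀T) le_rfl
  have h2 : ∫⁻ z in S, ‖v z.1 z.2‖ₑ ≤
      (C * ENNReal.ofReal t) ^ (1 / 2 : ℝ) * (volume S) ^ (1 / 2 : ℝ) := by
    have key := setLIntegral_le_rpow_mul_measure_rpow volume mv Real.HolderConjugate.two_two
    refine key.trans (mul_le_mul' (ENNReal.rpow_le_rpow ?_ (by norm_num)) le_rfl)
    refine le_trans (le_of_eq (lintegral_congr fun z => ?_)) h1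
    rw [← ENNReal.rpow_natCast]
    norm_num
  have h3 : ∫⁻ z in S, ‖π z.1 z.2‖ₑ ≤ C ^ (2 / 3 : ℝ) * (volume S) ^ (1 / 3 : ℝ) := by
    have hpq : (3 / 2 : ℝ).HolderConjugate 3 := Real.holderConjugate_iff.2 ⟨by norm_num, by norm_num⟩
    have key := setLIntegral_le_rpow_mul_measure_rpow volume mπ hpq
    rw [show (1 / (3 / 2) : ℝ) = 2 / 3 by norm_num] at key
    exact key.trans (mul_le_mul' (ENNReal.rpow_le_rpow ((lintegral_mono_set hSsubT).trans hP)
      (by norm_num)) le_rfl)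
  calc ‖∫ s in Ioo 0 t, ∫ x, I s x‖ₑ
      ≤ ∫⁻ s in Ioo 0 t, ∫⁻ x in ball (0 : E) 1, ‖I s x‖ₑ := hstep1
    _ ≤ _ := hstep2
    _ = _ := hstep3
    _ ≤ _ := by
        refine mul_le_mul' le_rfl ?_
        exact add_le_add (add_le_add h1 h2) h3

/-! ### A subsequence converging in `L²(B)` at a.e. time -/

/-- **From `L²` convergence on a cylinder to `L²(B_r)` convergence at a.e. time along a
subsequence.** If `∫∫_{(0,T)×B_r} F_j → 0` for nonnegative measurable `F_j`, then along a
subsequence `∫_{B_r} F_{n_i}(t, ·) → 0` for a.e. `t ∈ (0,T)` (choose `∫∫ F_{n_i} ≤ 2^{-i}`,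
Tonelli, and `∑_i ∫_{B_r} F_{n_i}(t,·) < ∞` a.e.). [folklore] -/
theorem exists_subseq_ae_tendsto_setLIntegral {T r : ℝ} {F : ℕ → ℝ × E → ℝ≥0∞}
    (hF : ∀ j, AEMeasurable (F j) (volume.restrict (Ioo 0 T ×ˢ ball (0 : E) r)))
    (hlim : Tendsto (fun j => ∫⁻ z in Ioo 0 T ×ˢ ball (0 : E) r, F j z) atTop (𝓝 0)) :
    ∃ ns : ℕ → ℕ, StrictMono ns ∧ ∀ᵐ t ∂(volume.restrict (Ioo 0 T)),
      Tendsto (fun i => ∫⁻ x in ball (0 : E) r, F (ns i) (t, x)) atTop (𝓝 0) := by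
  set a : ℕ → ℝ≥0∞ := fun j => ∫⁻ z in Ioo 0 T ×ˢ ball (0 : E) r, F j z with ha
  -- a summable subsequence
  have hex : ∀ i : ℕ, ∃ N, ∀ j ≥ N, a j ≤ (2⁻¹ : ℝ≥0∞) ^ i := by
    intro i
    have hpos : (0 : ℝ≥0∞) < (2⁻¹ : ℝ≥0∞) ^ i := ENNReal.pow_pos (by norm_num) _
    obtain ⟨N, hN⟩ := eventually_atTop.1 ((tendsto_order.1 hlim).2 _ hpos)
    exact ⟨N, fun j hj => (hN j hj).le⟩
  obtain ⟨ns, hns, hle⟩ := extraction_forall_of_eventually' hex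
  refine ⟨ns, hns, ?_⟩
  -- Tonelli
  set Φ : ℕ → ℝ → ℝ≥0∞ := fun j t => ∫⁻ x in ball (0 : E) r, F j (t, x) with hΦ
  have hprod : ∀ j, AEMeasurable (F j)
      (((volume : Measure ℝ).restrict (Ioo 0 T)).prod ((volume : Measure E).restrict (ball 0 r))) :=
    fun j => by rw [Measure.prod_restrict, ← Measure.volume_eq_prod]; exact hF j
  have hΦm : ∀ j, AEMeasurable (Φ j) ((volume : Measure ℝ).restrict (Ioo 0 T)) :=
    fun j => (hprod j).lintegral_prod_right'
  have hTon : ∀ j, a j = ∫⁻ t in Ioo 0 T, Φ j t := by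
    intro j
    have key := setLIntegral_prod (μ := (volume : Measure ℝ)) (ν := (volume : Measure E))
      (s := Ioo 0 T) (t := ball (0 : E) r) (F j) (by
        rw [← Measure.volume_eq_prod]; exact hF j)
    rw [← Measure.volume_eq_prod] at key
    exact key
  -- the series of the subsequence is integrable, hence finite a.e.
  have hsum : ∫⁻ t in Ioo 0 T, ∑' i, Φ (ns i) t ≠ ⊤ := by
    rw [lintegral_tsum fun i => hΦm (ns i)]
    have hgeo : (∑' i : ℕ, (2⁻¹ : ℝ≥0∞) ^ i) ≠ ⊤ := by
      rw [ENNReal.tsum_geometric, ENNReal.one_sub_inv_two, inv_inv]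
      exact ENNReal.ofNat_ne_top
    refine ne_top_of_le_ne_top hgeo (ENNReal.tsum_le_tsum fun i => ?_)
    rw [← hTon]
    exact hle i
  have hae : ∀ᵐ t ∂((volume : Measure ℝ).restrict (Ioo 0 T)), ∑' i, Φ (ns i) t < ⊤ :=
    ae_lt_top' (AEMeasurable.tsum fun i => hΦm (ns i)) hsum
  filter_upwards [hae] with t ht
  exact ENNReal.tendsto_atTop_zero_of_tsum_ne_top ht.ne

/-! ### Limits of the explicit bounds -/

/-- The volume of the layer `(0,s) × B_r` tends to `0` with `s`. [folklore] -/
theorem tendsto_volume_layer (r : ℝ) :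
    Tendsto (fun s : ℝ => volume (Ioo 0 s ×ˢ ball (0 : E) r)) (𝓝[>] 0) (𝓝 0) := by
  have e : ∀ s : ℝ, volume (Ioo 0 s ×ˢ ball (0 : E) r) =
      ENNReal.ofReal s * volume (ball (0 : E) r) := fun s => by
    rw [Measure.volume_eq_prod, Measure.prod_prod, Real.volume_Ioo, sub_zero]
  simp_rw [e]
  have h0 : Tendsto (fun s : ℝ => ENNReal.ofReal s) (𝓝[>] 0) (𝓝 0) := by
    have h := ENNReal.tendsto_ofReal (tendsto_id : Tendsto (fun s : ℝ => s) (𝓝 0) (𝓝 0))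
    rw [ENNReal.ofReal_zero] at h
    exact h.mono_left nhdsWithin_le_nhds
  have := ENNReal.Tendsto.mul_const h0
    (Or.inr (measure_ball_lt_top (μ := (volume : Measure E)) (x := (0 : E)) (r := r)).ne)
  rwa [zero_mul] at this

/-- `x ↦ x^p` is continuous at `0` in `ℝ≥0∞` (`p > 0`): along any `f → 0`, `f^p → 0`. [folklore] -/
theorem tendsto_ennreal_rpow_zero {ι : Type*} {l : Filter ι} {f : ι → ℝ≥0∞}
    (hf : Tendsto f l (𝓝 0)) {p : ℝ} (hp : 0 < p) : Tendsto (fun i => f i ^ p) l (𝓝 0) := by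
  have := ((ENNReal.continuous_rpow_const (y := p)).tendsto 0).comp hf
  rwa [ENNReal.zero_rpow_of_pos hp] at this

/-- The bound of `setLIntegral_energyFlux_le` tends to `0` with the height of the layer. [folklore] -/
theorem tendsto_energyFluxBound {D : ℝ} {C M : ℝ≥0∞} (hC : C ≠ ⊤) (hM : M ≠ ⊤) (r : ℝ) :
    Tendsto (fun s : ℝ => ENNReal.ofReal D * (C * ENNReal.ofReal s +
        M ^ (9 / 10 : ℝ) * (volume (Ioo 0 s ×ˢ ball (0 : E) r)) ^ (1 / 10 : ℝ) +
        2 * (C ^ (2 / 3 : ℝ) * (M ^ (9 / 10 : ℝ) *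
          (volume (Ioo 0 s ×ˢ ball (0 : E) r)) ^ (1 / 10 : ℝ)) ^ (1 / 3 : ℝ))))
      (𝓝[>] 0) (𝓝 0) := by
  have hV := tendsto_volume_layer (E := E) r
  have h0 : Tendsto (fun s : ℝ => ENNReal.ofReal s) (𝓝[>] 0) (𝓝 0) := by
    have h := ENNReal.tendsto_ofReal (tendsto_id : Tendsto (fun s : ℝ => s) (𝓝 0) (𝓝 0))
    rw [ENNReal.ofReal_zero] at h
    exact h.mono_left nhdsWithin_le_nhds
  have h1 : Tendsto (fun s : ℝ => C * ENNReal.ofReal s) (𝓝[>] 0) (𝓝 0) := by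
    have := ENNReal.Tendsto.const_mul h0 (Or.inr hC)
    rwa [mul_zero] at this
  have h2 : Tendsto (fun s : ℝ => M ^ (9 / 10 : ℝ) * (volume (Ioo 0 s ×ˢ ball (0 : E) r)) ^
      (1 / 10 : ℝ)) (𝓝[>] 0) (𝓝 0) := by
    have := ENNReal.Tendsto.const_mul (tendsto_ennreal_rpow_zero hV (by norm_num : (0:ℝ) < 1/10))
      (Or.inr (ENNReal.rpow_ne_top_of_nonneg (by norm_num : (0:ℝ) ≤ 9 / 10) hM))
    rwa [mul_zero] at this
  have h3 : Tendsto (fun s : ℝ => 2 * (C ^ (2 / 3 : ℝ) * (M ^ (9 / 10 : ℝ) *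
      (volume (Ioo 0 s ×ˢ ball (0 : E) r)) ^ (1 / 10 : ℝ)) ^ (1 / 3 : ℝ))) (𝓝[>] 0) (𝓝 0) := by
    have h31 := ENNReal.Tendsto.const_mul (tendsto_ennreal_rpow_zero h2 (by norm_num : (0:ℝ) < 1/3))
      (Or.inr (ENNReal.rpow_ne_top_of_nonneg (by norm_num) hC) : _ ∨ C ^ (2 / 3 : ℝ) ≠ ⊤)
    rw [mul_zero] at h31
    have := ENNReal.Tendsto.const_mul h31 (Or.inr ENNReal.ofNat_ne_top : _ ∨ (2 : ℝ≥0∞) ≠ ⊤)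
    rwa [mul_zero] at this
  have h4 := (h1.add h2).add h3
  rw [add_zero, add_zero] at h4
  have := ENNReal.Tendsto.const_mul h4 (Or.inr ENNReal.ofReal_ne_top : _ ∨ ENNReal.ofReal D ≠ ⊤)
  rwa [mul_zero] at this

/-- The bound of `enorm_setIntegral_pairingFlux_le` tends to `0` with the height of the layer. [folklore] -/
theorem tendsto_pairingFluxBound {D : ℝ} {C : ℝ≥0∞} (hC : C ≠ ⊤) :
    Tendsto (fun t : ℝ => ENNReal.ofReal D * (C * ENNReal.ofReal t +
        (C * ENNReal.ofReal t) ^ (1 / 2 : ℝ) * (volume (Ioo 0 t ×ˢ ball (0 : E) 1)) ^ (1 / 2 : ℝ) +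
        C ^ (2 / 3 : ℝ) * (volume (Ioo 0 t ×ˢ ball (0 : E) 1)) ^ (1 / 3 : ℝ)))
      (𝓝[>] 0) (𝓝 0) := by
  have hV := tendsto_volume_layer (E := E) 1
  have h0 : Tendsto (fun s : ℝ => ENNReal.ofReal s) (𝓝[>] 0) (𝓝 0) := by
    have h := ENNReal.tendsto_ofReal (tendsto_id : Tendsto (fun s : ℝ => s) (𝓝 0) (𝓝 0))
    rw [ENNReal.ofReal_zero] at h
    exact h.mono_left nhdsWithin_le_nhds
  have h1 : Tendsto (fun s : ℝ => C * ENNReal.ofReal s) (𝓝[>] 0) (𝓝 0) := by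
    have := ENNReal.Tendsto.const_mul h0 (Or.inr hC)
    rwa [mul_zero] at this
  have h2 : Tendsto (fun t : ℝ => (C * ENNReal.ofReal t) ^ (1 / 2 : ℝ) *
      (volume (Ioo 0 t ×ˢ ball (0 : E) 1)) ^ (1 / 2 : ℝ)) (𝓝[>] 0) (𝓝 0) := by
    have := ENNReal.Tendsto.mul (tendsto_ennreal_rpow_zero h1 (by norm_num : (0:ℝ) < 1/2))
      (Or.inr ENNReal.zero_ne_top) (tendsto_ennreal_rpow_zero hV (by norm_num : (0:ℝ) < 1/2))
      (Or.inr ENNReal.zero_ne_top)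
    rwa [mul_zero] at this
  have h3 : Tendsto (fun t : ℝ => C ^ (2 / 3 : ℝ) * (volume (Ioo 0 t ×ˢ ball (0 : E) 1)) ^
      (1 / 3 : ℝ)) (𝓝[>] 0) (𝓝 0) := by
    have := ENNReal.Tendsto.const_mul (tendsto_ennreal_rpow_zero hV (by norm_num : (0:ℝ) < 1/3))
      (Or.inr (ENNReal.rpow_ne_top_of_nonneg (by norm_num) hC) : _ ∨ C ^ (2 / 3 : ℝ) ≠ ⊤)
    rwa [mul_zero] at this
  have h4 := (h1.add h2).add h3
  rw [add_zero, add_zero] at h4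
  have := ENNReal.Tendsto.const_mul h4 (Or.inr ENNReal.ofReal_ne_top : _ ∨ ENNReal.ofReal D ≠ ⊤)
  rwa [mul_zero] at this

/-! ### The passage to the limit at a good time -/

/-- **Abstract form of the limit `i → ∞` at a fixed good time.** If
`A^{1/2} ≤ Φ_i^{1/2} + (2·ofReal(2W₀ + 2(P + e_i^{1/2} + Q)(e_i^{1/2} + D) + Fl) + 2e_i)^{1/2}`
for all large `i`, with `Φ_i → 0`, `e_i → 0` and `P, Q, D` finite, then
`A ≤ 2·ofReal(2W₀ + 2(P + Q) D + Fl)`. [folklore] -/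
theorem le_of_eventually_sqrt_le {A : ℝ≥0∞} {Φ e : ℕ → ℝ≥0∞} (hΦ : Tendsto Φ atTop (𝓝 0))
    (he : Tendsto e atTop (𝓝 0)) {P Q D : ℝ≥0∞} (hP : P ≠ ⊤) (hQ : Q ≠ ⊤) (hD : D ≠ ⊤)
    {W₀ Fl : ℝ}
    (h : ∀ᶠ i in atTop, A ^ (1 / 2 : ℝ) ≤ Φ i ^ (1 / 2 : ℝ) +
      (2 * ENNReal.ofReal (2 * W₀ + 2 * (P + e i ^ (1 / 2 : ℝ) + Q).toReal *
        (e i ^ (1 / 2 : ℝ) + D).toReal + Fl) + 2 * e i) ^ (1 / 2 : ℝ)) :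
    A ≤ 2 * ENNReal.ofReal (2 * W₀ + 2 * (P + Q).toReal * D.toReal + Fl) := by
  have he2 : Tendsto (fun i => e i ^ (1 / 2 : ℝ)) atTop (𝓝 0) :=
    tendsto_ennreal_rpow_zero he (by norm_num)
  have hΦ2 : Tendsto (fun i => Φ i ^ (1 / 2 : ℝ)) atTop (𝓝 0) :=
    tendsto_ennreal_rpow_zero hΦ (by norm_num)
  have h1 : Tendsto (fun i => (P + e i ^ (1 / 2 : ℝ) + Q).toReal) atTop (𝓝 (P + Q).toReal) := by
    have h := (tendsto_const_nhds (x := P)).add he2 |>.add (tendsto_const_nhds (x := Q))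
    rw [add_zero] at h
    exact (ENNReal.tendsto_toReal (ENNReal.add_ne_top.2 ⟨hP, hQ⟩)).comp h
  have h2 : Tendsto (fun i => (e i ^ (1 / 2 : ℝ) + D).toReal) atTop (𝓝 D.toReal) := by
    have h := he2.add (tendsto_const_nhds (x := D))
    rw [zero_add] at h
    exact (ENNReal.tendsto_toReal hD).comp h
  have h3 : Tendsto (fun i => 2 * W₀ + 2 * (P + e i ^ (1 / 2 : ℝ) + Q).toReal *
      (e i ^ (1 / 2 : ℝ) + D).toReal + Fl) atTop
      (𝓝 (2 * W₀ + 2 * (P + Q).toReal * D.toReal + Fl)) :=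
    ((tendsto_const_nhds.add ((h1.const_mul 2).mul h2)).add tendsto_const_nhds)
  have h4 := (ENNReal.continuous_ofReal.tendsto _).comp h3
  have h5 : Tendsto (fun i => 2 * ENNReal.ofReal (2 * W₀ + 2 * (P + e i ^ (1 / 2 : ℝ) + Q).toReal *
      (e i ^ (1 / 2 : ℝ) + D).toReal + Fl) + 2 * e i) atTop
      (𝓝 (2 * ENNReal.ofReal (2 * W₀ + 2 * (P + Q).toReal * D.toReal + Fl))) := by
    have ha := ENNReal.Tendsto.const_mul h4 (Or.inr ENNReal.ofNat_ne_top : _ ∨ (2 : ℝ≥0∞) ≠ ⊤)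
    have hb := ENNReal.Tendsto.const_mul he (Or.inr ENNReal.ofNat_ne_top : _ ∨ (2 : ℝ≥0∞) ≠ ⊤)
    have := ha.add hb
    rwa [mul_zero, add_zero] at this
  have h6 := ((ENNReal.continuous_rpow_const (y := (1 / 2 : ℝ))).tendsto _).comp h5
  have h7 := hΦ2.add h6
  rw [zero_add] at h7
  have key := ge_of_tendsto h7 h
  exact (ENNReal.rpow_le_rpow_iff (by norm_num : (0 : ℝ) < 1 / 2)).1 key

/-! ### The main estimate for a fixed compact set -/

/-- **Continuity of the limit at `t = 0` in `L²(K)`, a.e. form** (Bradshaw–Tsai 2019, §4.3: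
"For compact subsets `K` of `B₁`, we automatically have `lim_{t→0⁺} ‖v − v₀‖_{L²(K)} = 0`";
Lemarié-Rieusset 2016, Prop. 14.1). Under the hypotheses of `bradshawTsai2019_limitDatum`
(local Leray solutions `(v_k, π_k)` with data `w₀⁽ᵏ⁾ → v₀` in `L²(B₁)` and uniform bounds on
`(0,T) × B₁`, and `v_j → u` in `L²((0,T) × B₁)`), for every compact `K ⊆ B₁` and `ε > 0`
there is `δ > 0` with `∫_K |u(t) − v₀|² ≤ ε` for a.e. `t ∈ (0, δ)`. Proof: along a subsequence
`v_j(t) → u(t)` in `L²(B₁)` for a.e. `t`; at such `t`, combine the local energy inequality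
from `t = 0` (`IsLocalLeraySolution.ae_lintegral_sq_mul_le_datum_add`, flux
`≤ ω(t) → 0` uniformly by the `L^{10/3}` bound) and the weak continuity at `t = 0`
(`IsLocalLeraySolution.ae_pairing_eq_datum_add`, flux `≤ ω'(t) → 0` uniformly) through
`lintegral_sq_sub_mul_le_of_energy_of_pairing`, with test fields `φ_m → ψ v₀` in `L²`
(`FunctionSpaces.exists_isTestFunctionOn_eLpNorm_sub_le`), and let `j → ∞`. [cite: BradshawTsai2019, §4.3 (proof of Thm 1.2); LemarieRieusset2016 Prop. 14.1] -/
theorem exists_ae_restrict_lintegral_sub_datum_le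
    {v₀ : (EuclideanSpace ℝ (Fin 3)) → (EuclideanSpace ℝ (Fin 3))}
    (hm₀ : AEStronglyMeasurable v₀ volume)
    (hL2 : LocallyIntegrable (fun x => ‖v₀ x‖ ^ 2) volume)
    {w₀ : ℕ → (EuclideanSpace ℝ (Fin 3)) → (EuclideanSpace ℝ (Fin 3))}
    {v : ℕ → ℝ → (EuclideanSpace ℝ (Fin 3)) → (EuclideanSpace ℝ (Fin 3))}
    {π : ℕ → ℝ → (EuclideanSpace ℝ (Fin 3)) → ℝ} {T : ℝ} {C : ℝ≥0}
    (hw : ∀ k, AEStronglyMeasurable (w₀ k) volume)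
    (hconv : Tendsto (fun k => ∫⁻ x in ball (0 : EuclideanSpace ℝ (Fin 3)) 1,
      ‖w₀ k x - v₀ x‖ₑ ^ 2) atTop (𝓝 0))
    (hLL : ∀ k, IsLocalLeraySolution 1 (w₀ k) (v k) (π k)) (hT : 0 < T)
    (hE : ∀ k, ∀ᵐ t ∂(volume.restrict (Ioo 0 T)),
      ∫⁻ x in ball (0 : EuclideanSpace ℝ (Fin 3)) 1, ‖v k t x‖ₑ ^ 2 ≤ C)
    (hG : ∀ k, ∃ G : ℝ → (EuclideanSpace ℝ (Fin 3)) →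
        (EuclideanSpace ℝ (Fin 3)) →L[ℝ] (EuclideanSpace ℝ (Fin 3)),
      HasWeakSpatialGradientOn (slab (EuclideanSpace ℝ (Fin 3)) (Ioi 0) isOpen_Ioi) (v k) G ∧
      ∫⁻ z in Ioo 0 T ×ˢ ball (0 : EuclideanSpace ℝ (Fin 3)) 1,
        ENNReal.ofReal (frobeniusNormSq (G z.1 z.2)) ≤ C)
    (hP : ∀ k, ∫⁻ z in Ioo 0 T ×ˢ ball (0 : EuclideanSpace ℝ (Fin 3)) 1,
      ‖π k z.1 z.2‖ₑ ^ (3 / 2 : ℝ) ≤ C)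
    {u : ℝ → (EuclideanSpace ℝ (Fin 3)) → (EuclideanSpace ℝ (Fin 3))}
    (hum : AEStronglyMeasurable (uncurry u)
      (volume.restrict (Ioo 0 T ×ˢ ball (0 : EuclideanSpace ℝ (Fin 3)) 1)))
    (hstrong : Tendsto (fun j => ∫⁻ z in Ioo 0 T ×ˢ ball (0 : EuclideanSpace ℝ (Fin 3)) 1,
      ‖v j z.1 z.2 - u z.1 z.2‖ₑ ^ 2) atTop (𝓝 0))
    {K : Set (EuclideanSpace ℝ (Fin 3))} (hK : IsCompact K) (hKB : K ⊆ ball 0 1)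
    {ε : ℝ} (hε : 0 < ε) :
    ∃ δ > 0, ∀ᵐ t ∂(volume.restrict (Ioo 0 δ)),
      ∫⁻ x in K, ‖u t x - v₀ x‖ₑ ^ 2 ≤ ENNReal.ofReal ε := by
  -- Part 1: a ball `B_{r'} ⊇ K`, `r' < 1`, and a cut-off `ψ`
  obtain ⟨r', hr', hKr'⟩ := exists_pos_lt_subset_ball one_pos hK.isClosed hKB
  obtain ⟨ψ, hψs, hψcs, hψsupp, hψK, hψ01⟩ :=
    FunctionSpaces.exists_smooth_cutoff_mem_Icc hK isOpen_ball hKr'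
  have hψ0 : ∀ x, 0 ≤ ψ x := fun x => (hψ01 x).1
  have hψr' : ∀ x, x ∉ ball (0 : EuclideanSpace ℝ (Fin 3)) r' → ψ x = 0 := fun x hx =>
    image_eq_zero_of_notMem_tsupport fun h => hx (hψsupp h)
  have hψB1 : ∀ x, x ∉ ball (0 : EuclideanSpace ℝ (Fin 3)) 1 → ψ x = 0 := fun x hx =>
    hψr' x fun h => hx (ball_subset_ball hr'.2.le h)
  obtain ⟨Dψ, hΔψ, hgradψ⟩ : ∃ D : ℝ, (∀ x, |Δ ψ x| ≤ D) ∧ ∀ x, ‖gradient ψ x‖ ≤ D := by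
    have hψ2 : ContDiff ℝ 2 ψ := contDiff_infty.1 hψs 2
    have hcΔ : Continuous (Δ ψ) := continuous_laplacian hψ2
    have hcf : Continuous (fderiv ℝ ψ) := hψs.continuous_fderiv (by simp)
    have hcg : Continuous (gradient ψ) :=
      (InnerProductSpace.toDual ℝ (EuclideanSpace ℝ (Fin 3))).symm.continuous.comp hcf
    have hsΔ : HasCompactSupport (Δ ψ) :=
      HasCompactSupport.intro hψcs fun x hx => laplacian_eq_zero_of_notMem_tsupport hx
    have hsg : HasCompactSupport (gradient ψ) :=
      HasCompactSupport.intro hψcs fun x hx => by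
        simp [gradient, fderiv_of_notMem_tsupport ℝ hx]
    obtain ⟨D1, hD1⟩ := hcΔ.bounded_above_of_compact_support hsΔ
    obtain ⟨D2, hD2⟩ := hcg.bounded_above_of_compact_support hsg
    refine ⟨max D1 D2, fun x => ?_, fun x => (hD2 x).trans (le_max_right _ _)⟩
    have := hD1 x
    rw [Real.norm_eq_abs] at this
    exact this.trans (le_max_left _ _)
  -- Part 2: the uniform `L^{10/3}` bound and `|v_k|³ ∈ L¹` on the initial layer
  obtain ⟨T₀, hT₀, hT₀T, M, hM, hM10⟩ := exists_uniform_tenThirds_bound hT hE hG hr'.2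
  have hslab : ∀ (A : Set ℝ) (S : Set (EuclideanSpace ℝ (Fin 3))), A ⊆ Ioi 0 →
      A ×ˢ S ⊆ ((slab (EuclideanSpace ℝ (Fin 3)) (Ioi 0) isOpen_Ioi :
        Opens (ℝ × EuclideanSpace ℝ (Fin 3))) : Set (ℝ × EuclideanSpace ℝ (Fin 3))) :=
    fun A S hA z hz => mem_slab.2 (hA hz.1)
  have hvm : ∀ k (A : Set ℝ) (S : Set (EuclideanSpace ℝ (Fin 3))), A ⊆ Ioi 0 →
      AEStronglyMeasurable (uncurry (v k)) (volume.restrict (A ×ˢ S)) :=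
    fun k A S hA => ((hLL k).distributional.1.mono_set (hslab A S hA)).aestronglyMeasurable
  have hπm : ∀ k (A : Set ℝ) (S : Set (EuclideanSpace ℝ (Fin 3))), A ⊆ Ioi 0 →
      AEStronglyMeasurable (uncurry (π k)) (volume.restrict (A ×ˢ S)) :=
    fun k A S hA => ((hLL k).distributional.2.2.1.mono_set (hslab A S hA)).aestronglyMeasurable
  have hu3 : ∀ k, IntegrableOn (fun z : ℝ × EuclideanSpace ℝ (Fin 3) => ‖v k z.1 z.2‖ ^ 3)
      (Ioo 0 T₀ ×ˢ ball (0 : EuclideanSpace ℝ (Fin 3)) r') volume := by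
    intro k
    haveI : IsFiniteMeasure ((volume : Measure (ℝ × EuclideanSpace ℝ (Fin 3))).restrict
        (Ioo 0 T₀ ×ˢ ball (0 : EuclideanSpace ℝ (Fin 3)) r')) :=
      ⟨by rw [Measure.restrict_apply_univ, Measure.volume_eq_prod, Measure.prod_prod]
          exact ENNReal.mul_lt_top measure_Ioo_lt_top measure_ball_lt_top⟩
    have hm : AEStronglyMeasurable (fun z : ℝ × EuclideanSpace ℝ (Fin 3) => ‖v k z.1 z.2‖ ^ 3)
        (volume.restrict (Ioo 0 T₀ ×ˢ ball (0 : EuclideanSpace ℝ (Fin 3)) r')) :=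
      ((hvm k _ _ Ioo_subset_Ioi_self).norm.aemeasurable.pow_const 3).aestronglyMeasurable
    refine integrable_of_lintegral_rpow_enorm_lt_top hm (by norm_num : (1 : ℝ) ≤ 10 / 9) ?_
    calc ∫⁻ z in Ioo 0 T₀ ×ˢ ball (0 : EuclideanSpace ℝ (Fin 3)) r', ‖‖v k z.1 z.2‖ ^ 3‖ₑ ^ (10 / 9 : ℝ)
        = ∫⁻ z in Ioo 0 T₀ ×ˢ ball (0 : EuclideanSpace ℝ (Fin 3)) r', ‖v k z.1 z.2‖ₑ ^ (10 / 3 : ℝ) := by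
          refine lintegral_congr fun z => ?_
          rw [Real.enorm_eq_ofReal (pow_nonneg (norm_nonneg _) 3), ENNReal.ofReal_pow (norm_nonneg _),
            ofReal_norm, ← ENNReal.rpow_natCast, ← ENNReal.rpow_mul]
          norm_num
      _ ≤ M := hM10 k
      _ < ⊤ := hM
  -- Part 3: the local energy inequality from `t = 0` and its flux
  have hLEI : ∀ k, ∀ᵐ s ∂(volume.restrict (Ioo 0 (T₀ / 2))),
      ∫⁻ x, ‖v k s x‖ₑ ^ 2 * ENNReal.ofReal (ψ x) ≤
        (∫⁻ x, ‖w₀ k x‖ₑ ^ 2 * ENNReal.ofReal (ψ x)) +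
        ∫⁻ z in Ioo 0 s ×ˢ ball (0 : EuclideanSpace ℝ (Fin 3)) r',
          ‖‖v k z.1 z.2‖ ^ 2 * Δ ψ z.2 +
            (‖v k z.1 z.2‖ ^ 2 + 2 * π k z.1 z.2) * ⟪v k z.1 z.2, gradient ψ z.2⟫‖ₑ := fun k =>
    (hLL k).ae_lintegral_sq_mul_le_datum_add (hw k) hT₀ (hu3 k) hψs hψsupp hψ0
  set ω : ℝ → ℝ≥0∞ := fun s => ENNReal.ofReal Dψ * ((C : ℝ≥0∞) * ENNReal.ofReal s +
    M ^ (9 / 10 : ℝ) * (volume (Ioo 0 s ×ˢ ball (0 : EuclideanSpace ℝ (Fin 3)) r')) ^ (1 / 10 : ℝ) +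
    2 * ((C : ℝ≥0∞) ^ (2 / 3 : ℝ) * (M ^ (9 / 10 : ℝ) *
      (volume (Ioo 0 s ×ˢ ball (0 : EuclideanSpace ℝ (Fin 3)) r')) ^ (1 / 10 : ℝ)) ^ (1 / 3 : ℝ))) with hωdef
  have hFlω : ∀ k, ∀ s ∈ Ioc (0 : ℝ) T₀,
      ∫⁻ z in Ioo 0 s ×ˢ ball (0 : EuclideanSpace ℝ (Fin 3)) r',
        ‖‖v k z.1 z.2‖ ^ 2 * Δ ψ z.2 +
          (‖v k z.1 z.2‖ ^ 2 + 2 * π k z.1 z.2) * ⟪v k z.1 z.2, gradient ψ z.2⟫‖ₑ ≤ ω s :=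
    fun k s hs => setLIntegral_energyFlux_le (hvm k _ _ Ioo_subset_Ioi_self)
      (hπm k _ _ Ioo_subset_Ioi_self) hT₀T hr'.2.le (hE k) (hP k) (hM10 k) hΔψ hgradψ hs
  have hω : Tendsto ω (𝓝[>] 0) (𝓝 0) := tendsto_energyFluxBound ENNReal.coe_ne_top hM.ne r'
  -- Part 4: the datum in `L²(B₁)` and the test fields `φ m → ψ v₀`
  have hv₀B : ∫⁻ x in ball (0 : EuclideanSpace ℝ (Fin 3)) 1, ‖v₀ x‖ₑ ^ 2 < ⊤ :=
    setLIntegral_ball_enorm_sq_lt_top hL2 1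
  have hmemψv : MemLp (fun x => ψ x • v₀ x) 2
      (volume.restrict (ball (0 : EuclideanSpace ℝ (Fin 3)) r')) := by
    have h1 : MemLp v₀ 2 (volume.restrict (ball (0 : EuclideanSpace ℝ (Fin 3)) r')) :=
      memLp_two_restrict_of_lintegral_lt_top hm₀
        ((lintegral_mono_set (ball_subset_ball hr'.2.le)).trans_lt hv₀B)
    refine h1.of_le ((hψs.continuous.aestronglyMeasurable.smul hm₀).restrict)
      (Eventually.of_forall fun x => ?_)
    rw [norm_smul]
    refine mul_le_of_le_one_left (norm_nonneg _) ?_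
    rw [Real.norm_eq_abs, abs_of_nonneg (hψ0 x)]
    exact (hψ01 x).2
  have hφex : ∀ m : ℕ, ∃ φ : EuclideanSpace ℝ (Fin 3) → EuclideanSpace ℝ (Fin 3),
      FunctionSpaces.IsTestFunctionOn (⟨ball (0 : EuclideanSpace ℝ (Fin 3)) r', isOpen_ball⟩ :
        Opens (EuclideanSpace ℝ (Fin 3))) φ ∧
      eLpNorm ((fun x => ψ x • v₀ x) - φ) 2
        (volume.restrict (ball (0 : EuclideanSpace ℝ (Fin 3)) r')) ≤
        ENNReal.ofReal (1 / ((m : ℝ) + 1)) := fun m =>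
    FunctionSpaces.exists_isTestFunctionOn_eLpNorm_sub_le _ one_le_two ENNReal.ofNat_ne_top hmemψv
      (ENNReal.ofReal_pos.2 (by positivity)).ne'
  choose φ hφt hφerr using hφex
  have hφtop : ∀ m, FunctionSpaces.IsTestFunctionOn (⊤ : Opens (EuclideanSpace ℝ (Fin 3))) (φ m) :=
    fun m => (hφt m).mono le_top
  have hφr' : ∀ m x, x ∉ ball (0 : EuclideanSpace ℝ (Fin 3)) r' → φ m x = 0 := fun m x hx =>
    image_eq_zero_of_notMem_tsupport fun h => hx ((hφt m).tsupport_subset h)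
  have hφsupp1 : ∀ m, tsupport (φ m) ⊆ ball (0 : EuclideanSpace ℝ (Fin 3)) 1 := fun m =>
    (hφt m).tsupport_subset.trans (ball_subset_ball hr'.2.le)
  have hφB1 : ∀ m x, x ∉ ball (0 : EuclideanSpace ℝ (Fin 3)) 1 → φ m x = 0 := fun m x hx =>
    hφr' m x fun h => hx (ball_subset_ball hr'.2.le h)
  have hφD : ∀ m, ∃ D : ℝ, (∀ x, ‖fderiv ℝ (φ m) x‖ ≤ D) ∧ (∀ x, ‖Δ (φ m) x‖ ≤ D) ∧
      ∀ x, |VectorCalculus.divergence (φ m) x| ≤ D := by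
    intro m
    have hc : ContDiff ℝ (⊤ : ℕ∞) (φ m) := (hφt m).contDiff
    have hcs : HasCompactSupport (φ m) := (hφt m).hasCompactSupport
    have h2 : ContDiff ℝ 2 (φ m) := contDiff_infty.1 hc 2
    have hcf : Continuous (fderiv ℝ (φ m)) := hc.continuous_fderiv (by simp)
    have hcΔ : Continuous (Δ (φ m)) := continuous_laplacian h2
    have hcdiv : Continuous (VectorCalculus.divergence (φ m)) := by
      have e : VectorCalculus.divergence (φ m) = fun x => ∑ i,
          ⟪stdOrthonormalBasis ℝ (EuclideanSpace ℝ (Fin 3)) i,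
            fderiv ℝ (φ m) x (stdOrthonormalBasis ℝ (EuclideanSpace ℝ (Fin 3)) i)⟫ := by
        funext x
        exact divergence_eq_sum_inner_fderiv (stdOrthonormalBasis ℝ _) (φ m) x
      rw [e]
      exact continuous_finsetSum _ fun i _ => continuous_const.inner (hcf.clm_apply continuous_const)
    have hsf : HasCompactSupport (fderiv ℝ (φ m)) :=
      HasCompactSupport.intro hcs fun x hx => fderiv_of_notMem_tsupport ℝ hx
    have hsΔ : HasCompactSupport (Δ (φ m)) :=
      HasCompactSupport.intro hcs fun x hx => laplacian_eq_zero_of_notMem_tsupport hx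
    have hsdiv : HasCompactSupport (VectorCalculus.divergence (φ m)) :=
      HasCompactSupport.intro hcs fun x hx => by
        simp [VectorCalculus.divergence, fderiv_of_notMem_tsupport ℝ hx]
    obtain ⟨D1, hD1⟩ := hcf.bounded_above_of_compact_support hsf
    obtain ⟨D2, hD2⟩ := hcΔ.bounded_above_of_compact_support hsΔ
    obtain ⟨D3, hD3⟩ := hcdiv.bounded_above_of_compact_support hsdiv
    refine ⟨max (max D1 D2) D3, fun x => (hD1 x).trans ((le_max_left _ _).trans (le_max_left _ _)),
      fun x => (hD2 x).trans ((le_max_right _ _).trans (le_max_left _ _)), fun x => ?_⟩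
    have := hD3 x
    rw [Real.norm_eq_abs] at this
    exact this.trans (le_max_right _ _)
  choose Dφ hDφ1 hDφ2 hDφ3 using hφD
  have hDm : ∀ m, eLpNorm (fun x => ψ x • v₀ x - φ m x) 2
      (volume.restrict (ball (0 : EuclideanSpace ℝ (Fin 3)) 1)) ≤ ENNReal.ofReal (1 / ((m : ℝ) + 1)) := by
    intro m
    have hsup : support (fun x => ψ x • v₀ x - φ m x) ⊆ ball (0 : EuclideanSpace ℝ (Fin 3)) r' := by
      intro x hx
      by_contra h
      exact hx (by simp [hψr' x h, hφr' m x h])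
    rw [eLpNorm_restrict_eq_of_support_subset (hsup.trans (ball_subset_ball hr'.2.le)),
      ← eLpNorm_restrict_eq_of_support_subset hsup]
    exact hφerr m
  -- Part 5: the weak continuity at `t = 0` and its flux
  have hW : ∀ k m, ∀ᵐ t ∂(volume.restrict (Ioo 0 T₀)),
      ∫ x, ⟪v k t x, φ m x⟫ = (∫ x, ⟪w₀ k x, φ m x⟫) +
        ∫ s in Ioc 0 t, ∫ x, (⟪v k s x, convect (v k s) (φ m) x⟫ + ⟪v k s x, Δ (φ m) x⟫ +
          π k s x * VectorCalculus.divergence (φ m) x) := fun k m =>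
    (hLL k).ae_pairing_eq_datum_add (hw k) hT₀ (hφtop m)
  set ω' : ℕ → ℝ → ℝ≥0∞ := fun m t => ENNReal.ofReal (Dφ m) * ((C : ℝ≥0∞) * ENNReal.ofReal t +
    ((C : ℝ≥0∞) * ENNReal.ofReal t) ^ (1 / 2 : ℝ) *
      (volume (Ioo 0 t ×ˢ ball (0 : EuclideanSpace ℝ (Fin 3)) 1)) ^ (1 / 2 : ℝ) +
    (C : ℝ≥0∞) ^ (2 / 3 : ℝ) * (volume (Ioo 0 t ×ˢ ball (0 : EuclideanSpace ℝ (Fin 3)) 1)) ^ (1 / 3 : ℝ))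
    with hω'def
  have hFω' : ∀ k m, ∀ t ∈ Ioc (0 : ℝ) T₀,
      ‖∫ s in Ioo 0 t, ∫ x, (⟪v k s x, convect (v k s) (φ m) x⟫ + ⟪v k s x, Δ (φ m) x⟫ +
        π k s x * VectorCalculus.divergence (φ m) x)‖ₑ ≤ ω' m t := fun k m t ht =>
    enorm_setIntegral_pairingFlux_le (hvm k _ _ Ioo_subset_Ioi_self) (hπm k _ _ Ioo_subset_Ioi_self)
      hT₀T (hE k) (hP k) (hDφ1 m) (hDφ2 m) (hDφ3 m) (hφsupp1 m) ht
  have hω' : ∀ m, Tendsto (ω' m) (𝓝[>] 0) (𝓝 0) := fun m =>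
    tendsto_pairingFluxBound ENNReal.coe_ne_top
  -- Part 6: the subsequence and the good slices
  obtain ⟨ns, hns, hsub⟩ := exists_subseq_ae_tendsto_setLIntegral
    (F := fun j (z : ℝ × EuclideanSpace ℝ (Fin 3)) => ‖v j z.1 z.2 - u z.1 z.2‖ₑ ^ 2)
    (fun j => (((hvm j _ _ Ioo_subset_Ioi_self).sub hum).enorm.pow_const 2)) hstrong
  have hgoodv : ∀ k, ∀ᵐ t ∂(volume.restrict (Ioo 0 T)),
      AEStronglyMeasurable (v k t) (volume : Measure (EuclideanSpace ℝ (Fin 3))) := by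
    intro k
    have hmeas : AEStronglyMeasurable (uncurry (v k))
        ((volume : Measure (ℝ × EuclideanSpace ℝ (Fin 3))).restrict (Ioo 0 T ×ˢ univ)) :=
      hvm k _ _ Ioo_subset_Ioi_self
    filter_upwards [ae_slice_aestronglyMeasurable_and_lintegral_ball_lt_top hmeas
      (fun K' hK' => (hLL k).sqIntegrable T hT K' hK')] with t ht using ht.1
  have hgoodu : ∀ᵐ t ∂(volume.restrict (Ioo 0 T)),
      AEStronglyMeasurable (u t) (volume.restrict (ball (0 : EuclideanSpace ℝ (Fin 3)) 1)) := by
    have h := hum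
    rw [Measure.volume_eq_prod, ← Measure.prod_restrict] at h
    exact h.prodMk_left
  -- Part 7: the choice of `m` and of `δ`
  set N₀ : ℝ≥0∞ := ∫⁻ x in ball (0 : EuclideanSpace ℝ (Fin 3)) 1, ‖v₀ x‖ₑ ^ 2 with hN₀
  have hPfin : N₀ ^ (1 / 2 : ℝ) ≠ ⊤ := ENNReal.rpow_ne_top_of_nonneg (by norm_num) hv₀B.ne
  have hQfin : (C : ℝ≥0∞) ^ (1 / 2 : ℝ) ≠ ⊤ :=
    ENNReal.rpow_ne_top_of_nonneg (by norm_num) ENNReal.coe_ne_top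
  set Qr : ℝ := (N₀ ^ (1 / 2 : ℝ) + (C : ℝ≥0∞) ^ (1 / 2 : ℝ)).toReal with hQr
  have hQr0 : 0 ≤ Qr := ENNReal.toReal_nonneg
  obtain ⟨m, hm⟩ : ∃ m : ℕ, 16 * Qr / ε < (m : ℝ) + 1 := by
    obtain ⟨m, hm⟩ := exists_nat_gt (16 * Qr / ε)
    exact ⟨m, hm.trans (lt_add_one _)⟩
  have hm' : Qr * (1 / ((m : ℝ) + 1)) ≤ ε / 16 := by
    rw [div_lt_iff₀ hε] at hm
    rw [mul_one_div, div_le_iff₀ (by positivity : (0 : ℝ) < (m : ℝ) + 1)]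
    linarith
  -- `δ₁`: both fluxes are small on `(0, δ₁)`
  have hev1 : ∀ᶠ t in 𝓝[>] (0 : ℝ), ω' m t < ENNReal.ofReal (ε / 16) :=
    (tendsto_order.1 (hω' m)).2 _ (ENNReal.ofReal_pos.2 (by positivity))
  have hev2 : ∀ᶠ t in 𝓝[>] (0 : ℝ), ω t < ENNReal.ofReal (ε / 8) :=
    (tendsto_order.1 hω).2 _ (ENNReal.ofReal_pos.2 (by positivity))
  obtain ⟨δ₁, hδ₁, hδ₁sub⟩ := mem_nhdsGT_iff_exists_Ioo_subset.1 (hev1.and hev2)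
  refine ⟨min δ₁ (T₀ / 2), lt_min hδ₁ (half_pos hT₀), ?_⟩
  -- Part 8: the good slices in `(0, T₀/2)`
  have hsubT : Ioo 0 (T₀ / 2) ⊆ Ioo 0 T := Ioo_subset_Ioo_right (by linarith)
  have hsubT₀ : Ioo 0 (T₀ / 2) ⊆ Ioo 0 T₀ := Ioo_subset_Ioo_right (by linarith)
  have hall : ∀ᵐ t ∂(volume.restrict (Ioo 0 (T₀ / 2))),
      Tendsto (fun i => ∫⁻ x in ball (0 : EuclideanSpace ℝ (Fin 3)) 1,
        ‖v (ns i) t x - u t x‖ₑ ^ 2) atTop (𝓝 0) ∧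
      (∀ k, ∫⁻ x in ball (0 : EuclideanSpace ℝ (Fin 3)) 1, ‖v k t x‖ₑ ^ 2 ≤ C) ∧
      (∀ k, AEStronglyMeasurable (v k t) (volume : Measure (EuclideanSpace ℝ (Fin 3)))) ∧
      (∀ k, ∫⁻ x, ‖v k t x‖ₑ ^ 2 * ENNReal.ofReal (ψ x) ≤
        (∫⁻ x, ‖w₀ k x‖ₑ ^ 2 * ENNReal.ofReal (ψ x)) +
        ∫⁻ z in Ioo 0 t ×ˢ ball (0 : EuclideanSpace ℝ (Fin 3)) r',
          ‖‖v k z.1 z.2‖ ^ 2 * Δ ψ z.2 +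
            (‖v k z.1 z.2‖ ^ 2 + 2 * π k z.1 z.2) * ⟪v k z.1 z.2, gradient ψ z.2⟫‖ₑ) ∧
      (∀ k m', ∫ x, ⟪v k t x, φ m' x⟫ = (∫ x, ⟪w₀ k x, φ m' x⟫) +
        ∫ s in Ioc 0 t, ∫ x, (⟪v k s x, convect (v k s) (φ m') x⟫ + ⟪v k s x, Δ (φ m') x⟫ +
          π k s x * VectorCalculus.divergence (φ m') x)) ∧
      AEStronglyMeasurable (u t) (volume.restrict (ball (0 : EuclideanSpace ℝ (Fin 3)) 1)) := by
    refine (ae_restrict_of_ae_restrict_of_subset hsubT hsub).and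
      ((ae_all_iff.2 fun k => ae_restrict_of_ae_restrict_of_subset hsubT (hE k)).and
      ((ae_all_iff.2 fun k => ae_restrict_of_ae_restrict_of_subset hsubT (hgoodv k)).and
      ((ae_all_iff.2 fun k => hLEI k).and
      ((ae_all_iff.2 fun k => ae_all_iff.2 fun m' =>
        ae_restrict_of_ae_restrict_of_subset hsubT₀ (hW k m')).and
      (ae_restrict_of_ae_restrict_of_subset hsubT hgoodu)))))
  have hall' := ae_restrict_of_ae_restrict_of_subset
    (Ioo_subset_Ioo_right (min_le_right δ₁ (T₀ / 2))) hall
  filter_upwards [hall', ae_restrict_mem measurableSet_Ioo] with t ⟨h1, h2, h3, h4, h5, h6⟩ ht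
  have htT₀ : t ∈ Ioc (0 : ℝ) T₀ := ⟨ht.1, by linarith [ht.2, min_le_right δ₁ (T₀ / 2)]⟩
  have htδ₁ : t ∈ Ioo (0 : ℝ) δ₁ := ⟨ht.1, ht.2.trans_le (min_le_left _ _)⟩
  obtain ⟨hω't, hωt⟩ := hδ₁sub htδ₁
  have hω'fin : ω' m t ≠ ⊤ := (hω't.trans ENNReal.ofReal_lt_top).ne
  have hωfin : ω t ≠ ⊤ := (hωt.trans ENNReal.ofReal_lt_top).ne
  have hW₀ : (ω' m t).toReal ≤ ε / 16 := ENNReal.toReal_le_of_le_ofReal (by positivity) hω't.le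
  have hFl : (ω t).toReal ≤ ε / 8 := ENNReal.toReal_le_of_le_ofReal (by positivity) hωt.le
  -- the data along the subsequence
  have he : Tendsto (fun i => ∫⁻ x in ball (0 : EuclideanSpace ℝ (Fin 3)) 1,
      ‖w₀ (ns i) x - v₀ x‖ₑ ^ 2) atTop (𝓝 0) := hconv.comp hns.tendsto_atTop
  have hefin : ∀ᶠ i in atTop, ∫⁻ x in ball (0 : EuclideanSpace ℝ (Fin 3)) 1,
      ‖w₀ (ns i) x - v₀ x‖ₑ ^ 2 < 1 := (tendsto_order.1 he).2 _ zero_lt_one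
  set Dm : ℝ≥0∞ := eLpNorm (fun x => ψ x • v₀ x - φ m x) 2
    (volume.restrict (ball (0 : EuclideanSpace ℝ (Fin 3)) 1)) with hDmdef
  have hDmfin : Dm ≠ ⊤ := ((hDm m).trans_lt ENNReal.ofReal_lt_top).ne
  -- the estimate for each large `i`
  have hstep : ∀ᶠ i in atTop,
      (∫⁻ x in K, ‖u t x - v₀ x‖ₑ ^ 2) ^ (1 / 2 : ℝ) ≤
        (∫⁻ x in ball (0 : EuclideanSpace ℝ (Fin 3)) 1, ‖v (ns i) t x - u t x‖ₑ ^ 2) ^ (1 / 2 : ℝ) +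
        (2 * ENNReal.ofReal (2 * (ω' m t).toReal +
          2 * (N₀ ^ (1 / 2 : ℝ) + (∫⁻ x in ball (0 : EuclideanSpace ℝ (Fin 3)) 1,
            ‖w₀ (ns i) x - v₀ x‖ₑ ^ 2) ^ (1 / 2 : ℝ) + (C : ℝ≥0∞) ^ (1 / 2 : ℝ)).toReal *
          ((∫⁻ x in ball (0 : EuclideanSpace ℝ (Fin 3)) 1,
            ‖w₀ (ns i) x - v₀ x‖ₑ ^ 2) ^ (1 / 2 : ℝ) + Dm).toReal + (ω t).toReal) +
          2 * ∫⁻ x in ball (0 : EuclideanSpace ℝ (Fin 3)) 1, ‖w₀ (ns i) x - v₀ x‖ₑ ^ 2) ^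
            (1 / 2 : ℝ) := by
    filter_upwards [hefin] with i hi
    -- the one-step estimate for `a = v (ns i) t`, `b = w₀ (ns i)`
    have hLEIt : ∫⁻ x, ‖v (ns i) t x‖ₑ ^ 2 * ENNReal.ofReal (ψ x) ≤
        (∫⁻ x, ‖w₀ (ns i) x‖ₑ ^ 2 * ENNReal.ofReal (ψ x)) + ω t :=
      (h4 (ns i)).trans (add_le_add le_rfl (hFlω (ns i) t htT₀))
    have hWt : |(∫ x, ⟪v (ns i) t x, φ m x⟫) - ∫ x, ⟪w₀ (ns i) x, φ m x⟫| ≤ (ω' m t).toReal := by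
      have e1 : (∫ x, ⟪v (ns i) t x, φ m x⟫) - ∫ x, ⟪w₀ (ns i) x, φ m x⟫ =
          ∫ s in Ioo 0 t, ∫ x, (⟪v (ns i) s x, convect (v (ns i) s) (φ m) x⟫ +
            ⟪v (ns i) s x, Δ (φ m) x⟫ + π (ns i) s x * VectorCalculus.divergence (φ m) x) := by
        rw [h5 (ns i) m, add_sub_cancel_left]
        exact setIntegral_congr_set Ioo_ae_eq_Ioc.symm
      rw [e1, show ∀ r : ℝ, |r| = (‖r‖ₑ).toReal from fun r => by
        rw [Real.enorm_eq_ofReal_abs, ENNReal.toReal_ofReal (abs_nonneg _)]]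
      exact ENNReal.toReal_mono hω'fin (hFω' (ns i) m t htT₀)
    have hCi := lintegral_sq_sub_mul_le_of_energy_of_pairing measurableSet_ball
      measure_ball_lt_top.ne hψs.continuous hψ01 hψB1 (h3 (ns i)) (hw (ns i)) hm₀
      (hφtop m).contDiff.continuous (hφtop m).hasCompactSupport (hφB1 m) (h2 (ns i))
      ENNReal.coe_ne_top (hi.trans ENNReal.one_lt_top).ne hv₀B.ne hωfin hLEIt hWt
    -- the triangle inequality in `L²(K)`
    have hmu : AEStronglyMeasurable (u t) (volume.restrict K) :=
      h6.mono_measure (Measure.restrict_mono hKB le_rfl)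
    have hma : AEStronglyMeasurable (v (ns i) t) (volume.restrict K) := (h3 (ns i)).restrict
    have hmv₀ : AEStronglyMeasurable v₀ (volume.restrict K) := hm₀.restrict
    have htri : eLpNorm (fun x => u t x - v₀ x) 2 (volume.restrict K) ≤
        eLpNorm (fun x => u t x - v (ns i) t x) 2 (volume.restrict K) +
        eLpNorm (fun x => v (ns i) t x - v₀ x) 2 (volume.restrict K) := by
      have e : (fun x => u t x - v₀ x) =
          (fun x => u t x - v (ns i) t x) + (fun x => v (ns i) t x - v₀ x) := by
        funext x; simp
      rw [e]
      exact eLpNorm_add_le (hmu.sub hma) (hma.sub hmv₀) one_le_two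
    have hI : eLpNorm (fun x => u t x - v (ns i) t x) 2 (volume.restrict K) ≤
        (∫⁻ x in ball (0 : EuclideanSpace ℝ (Fin 3)) 1, ‖v (ns i) t x - u t x‖ₑ ^ 2) ^ (1 / 2 : ℝ) := by
      rw [eLpNorm_two_eq_rpow]
      refine ENNReal.rpow_le_rpow ((lintegral_mono_set hKB).trans (lintegral_mono fun x => ?_))
        (by norm_num)
      rw [← enorm_neg, neg_sub]
    have hII : eLpNorm (fun x => v (ns i) t x - v₀ x) 2 (volume.restrict K) ≤
        (∫⁻ x, ‖v (ns i) t x - v₀ x‖ₑ ^ 2 * ENNReal.ofReal (ψ x)) ^ (1 / 2 : ℝ) := by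
      rw [eLpNorm_two_eq_rpow]
      refine ENNReal.rpow_le_rpow ?_ (by norm_num)
      calc ∫⁻ x in K, ‖v (ns i) t x - v₀ x‖ₑ ^ 2
          = ∫⁻ x in K, ‖v (ns i) t x - v₀ x‖ₑ ^ 2 * ENNReal.ofReal (ψ x) :=
            setLIntegral_congr_fun hK.measurableSet fun x hx => by
              rw [hψK x hx, ENNReal.ofReal_one, mul_one]
        _ ≤ ∫⁻ x, ‖v (ns i) t x - v₀ x‖ₑ ^ 2 * ENNReal.ofReal (ψ x) :=
            lintegral_mono' Measure.restrict_le_self le_rfl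
    rw [← eLpNorm_two_eq_rpow]
    exact htri.trans (add_le_add hI (hII.trans (ENNReal.rpow_le_rpow hCi (by norm_num))))
  -- the limit `i → ∞`
  have key := le_of_eventually_sqrt_le (A := ∫⁻ x in K, ‖u t x - v₀ x‖ₑ ^ 2) h1 he hPfin hQfin
    hDmfin hstep
  refine key.trans ?_
  have hDmr : Dm.toReal ≤ 1 / ((m : ℝ) + 1) := ENNReal.toReal_le_of_le_ofReal (by positivity) (hDm m)
  have hQD : Qr * Dm.toReal ≤ ε / 16 := (mul_le_mul_of_nonneg_left hDmr hQr0).trans hm'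
  have hW₀0 : 0 ≤ (ω' m t).toReal := ENNReal.toReal_nonneg
  have hFl0 : 0 ≤ (ω t).toReal := ENNReal.toReal_nonneg
  rw [← ENNReal.ofReal_ofNat, ← ENNReal.ofReal_mul zero_le_two]
  refine ENNReal.ofReal_le_ofReal ?_
  have : 2 * Qr * Dm.toReal = 2 * (Qr * Dm.toReal) := by ring
  rw [this]
  linarith

end BradshawTsai2019

/-! ### The discharge of `bradshawTsai2019_limitDatum` -/

/-- **Proof of the named fact `bradshawTsai2019_limitDatum`** (Bradshaw–Tsai 2019, §4.3:
"For compact subsets `K` of `B₁`, we automatically have `lim_{t→0⁺} ‖v − v₀‖_{L²(K)} = 0`";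
Lemarié-Rieusset 2016, Prop. 14.1). By `BradshawTsai2019.exists_ae_restrict_lintegral_sub_datum_le`
(applied along the given subsequence, to the compact balls `B̄_{1−1/(n+2)}` and `ε = 1/(p+1)`),
off a null set `N` of times the limit `u` satisfies `∫_{B̄_{1−1/(n+2)}} |u(t) − v₀|² ≤ 1/(p+1)`
for `0 < t < δ_{n,p}`; re-defining the slices of `u` over `N` as `v₀` gives the representative
`u'` attaining the datum in `L²(K)` for every compact `K ⊆ B₁` and every `t → 0⁺`. [cite: BradshawTsai2019, §4.3 (proof of Thm 1.2); LemarieRieusset2016 Prop. 14.1] -/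
theorem bradshawTsai2019_limitDatum_holds : bradshawTsai2019_limitDatum := by
  intro v₀ hm₀ hL2 w₀ v π T C hw hconv hLL hT hE hG hP σ u hσ hum hstrong
  classical
  -- the main estimate along the subsequence, for the balls `B̄_{ρ n}` and `ε = 1/(p+1)`
  set ρ : ℕ → ℝ := fun n => 1 - 1 / ((n : ℝ) + 2) with hρ
  have hρ1 : ∀ n, ρ n < 1 := fun n => by
    simp only [hρ]; linarith [one_div_pos.2 (by positivity : (0 : ℝ) < (n : ℝ) + 2)]
  have hKn : ∀ n, IsCompact (closedBall (0 : EuclideanSpace ℝ (Fin 3)) (ρ n)) := fun n =>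
    isCompact_closedBall _ _
  have hKnB : ∀ n, closedBall (0 : EuclideanSpace ℝ (Fin 3)) (ρ n) ⊆ ball 0 1 := fun n =>
    closedBall_subset_ball (hρ1 n)
  have hmain : ∀ n p : ℕ, ∃ δ > 0, ∀ᵐ t ∂(volume.restrict (Ioo 0 δ)),
      ∫⁻ x in closedBall (0 : EuclideanSpace ℝ (Fin 3)) (ρ n), ‖u t x - v₀ x‖ₑ ^ 2 ≤
        ENNReal.ofReal (1 / ((p : ℝ) + 1)) := fun n p =>
    BradshawTsai2019.exists_ae_restrict_lintegral_sub_datum_le hm₀ hL2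
      (w₀ := fun j => w₀ (σ j)) (v := fun j => v (σ j)) (π := fun j => π (σ j))
      (fun j => hw (σ j)) (hconv.comp hσ.tendsto_atTop) (fun j => hLL (σ j)) hT
      (fun j => hE (σ j)) (fun j => hG (σ j)) (fun j => hP (σ j)) hum hstrong (hKn n) (hKnB n)
      (by positivity)
  choose δ hδ hae using hmain
  -- the null set of bad times
  set N : Set ℝ := ⋃ n : ℕ, ⋃ p : ℕ, {t | t ∈ Ioo 0 (δ n p) ∧
    ¬ (∫⁻ x in closedBall (0 : EuclideanSpace ℝ (Fin 3)) (ρ n), ‖u t x - v₀ x‖ₑ ^ 2 ≤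
      ENNReal.ofReal (1 / ((p : ℝ) + 1)))} with hN
  have hNnull : volume N = 0 := by
    refine measure_iUnion_null fun n => measure_iUnion_null fun p => ?_
    have h := (ae_restrict_iff' (measurableSet_Ioo (a := (0 : ℝ)) (b := δ n p))).1 (hae n p)
    rw [ae_iff] at h
    convert h using 2
    ext t
    simp only [mem_setOf_eq, Classical.not_imp]
  have hNmem : ∀ {t n p}, t ∈ Ioo 0 (δ n p) → t ∉ N →
      ∫⁻ x in closedBall (0 : EuclideanSpace ℝ (Fin 3)) (ρ n), ‖u t x - v₀ x‖ₑ ^ 2 ≤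
        ENNReal.ofReal (1 / ((p : ℝ) + 1)) := by
    intro t n p ht htN
    by_contra h
    exact htN (mem_iUnion₂.2 ⟨n, p, ht, h⟩)
  -- the modification
  refine ⟨fun t x => if t ∈ N then v₀ x else u t x, ?_, ?_⟩
  · -- `u' = u` a.e. on the cylinder
    have hprod : volume (N ×ˢ (univ : Set (EuclideanSpace ℝ (Fin 3)))) = 0 := by
      rw [Measure.volume_eq_prod, Measure.prod_prod, hNnull, zero_mul]
    refine ae_restrict_of_ae ?_
    filter_upwards [measure_eq_zero_iff_ae_notMem.1 hprod] with z hz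
    have hz' : z.1 ∉ N := fun h => hz ⟨h, mem_univ _⟩
    simp only [uncurry, if_neg hz']
  · -- the datum is attained for every compact `K ⊆ B₁`
    intro K hK hKB
    obtain ⟨r', hr', hKr'⟩ := exists_pos_lt_subset_ball one_pos hK.isClosed hKB
    -- a ball of the family containing `K`
    obtain ⟨n, hn⟩ : ∃ n : ℕ, r' ≤ ρ n := by
      obtain ⟨n, hn⟩ := exists_nat_ge (1 / (1 - r'))
      refine ⟨n, ?_⟩
      have h1 : 0 < 1 - r' := by linarith [hr'.2]
      have h2 : 1 / ((n : ℝ) + 2) ≤ 1 - r' := by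
        rw [div_le_iff₀ (by positivity)]
        rw [div_le_iff₀ h1] at hn
        nlinarith
      simp only [hρ]
      linarith
    have hKsub : K ⊆ closedBall (0 : EuclideanSpace ℝ (Fin 3)) (ρ n) :=
      hKr'.trans (ball_subset_closedBall.trans (closedBall_subset_closedBall hn))
    rw [ENNReal.tendsto_nhds_zero]
    intro ε hε
    -- `p` with `1/(p+1) ≤ ε`
    obtain ⟨p, hp⟩ : ∃ p : ℕ, ENNReal.ofReal (1 / ((p : ℝ) + 1)) < ε := by
      have h0 : Tendsto (fun p : ℕ => ENNReal.ofReal (1 / ((p : ℝ) + 1))) atTop (𝓝 0) := by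
        have := ENNReal.tendsto_ofReal (tendsto_one_div_add_atTop_nhds_zero_nat)
        rwa [ENNReal.ofReal_zero] at this
      exact ((tendsto_order.1 h0).2 ε hε).exists
    filter_upwards [Ioo_mem_nhdsGT (hδ n p)] with t ht
    by_cases htN : t ∈ N
    · simp only [if_pos htN, sub_self, enorm_zero, ne_eq, OfNat.ofNat_ne_zero,
        not_false_eq_true, zero_pow, lintegral_const, zero_mul, zero_le]
    · simp only [if_neg htN]
      exact ((lintegral_mono_set hKsub).trans (hNmem ht htN)).trans hp.le

/-- **The compactness fact on the unit cylinder from interior compactness alone**: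
`bradshawTsai2019_cylinderCompactness → bradshawTsai2019_cylinderLimit`
(`bradshawTsai2019_cylinderLimit_of_parts` with the proved `bradshawTsai2019_limitDatum_holds`). [cite: BradshawTsai2019, §4.3 (proof of Thm 1.2)] -/
theorem bradshawTsai2019_cylinderLimit_of_compactness (hC : bradshawTsai2019_cylinderCompactness) :
    bradshawTsai2019_cylinderLimit :=
  bradshawTsai2019_cylinderLimit_of_parts hC bradshawTsai2019_limitDatum_holds

/-- **The limit fact of Bradshaw–Tsai 2019, §4.3, as originally vendored, from interior
compactness of suitable weak solutions alone**:
`bradshawTsai2019_cylinderCompactness → bradshawTsai2019_limit_4_3`. Everything else in §4.2–§4.3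
— the DSS bookkeeping, the normalisation of the pressures, the extension, and the attainment of
the datum — is proved in the tree. [cite: BradshawTsai2019, §4.3 (proof of Thm 1.2) with §4.2] -/
theorem bradshawTsai2019_limit_4_3_of_compactness (hC : bradshawTsai2019_cylinderCompactness) :
    bradshawTsai2019_limit_4_3 :=
  bradshawTsai2019_limit_4_3_of_parts hC bradshawTsai2019_limitDatum_holds

/-- **Theorem 1.2 of Bradshaw–Tsai 2019 from Lemma 4.1, Prop. 3.1 (as printed) and interior
compactness of suitable weak solutions on the unit cylinder**: the trust base of
`bradshawTsai2019_dss_existence` in the tree is `{bradshawTsai2019_lemma_4_1,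
bradshawTsai2019_prop_3_1, bradshawTsai2019_cylinderCompactness}`. [cite: BradshawTsai2019, Thm 1.2 (proof, §4.3)] -/
theorem bradshawTsai2019_dss_existence_of_prop_3_1_compactness (h41 : bradshawTsai2019_lemma_4_1)
    (h31 : bradshawTsai2019_prop_3_1) (hC : bradshawTsai2019_cylinderCompactness) :
    bradshawTsai2019_dss_existence :=
  bradshawTsai2019_dss_existence_of_prop_3_1_parts h41 h31 hC bradshawTsai2019_limitDatum_holds

/-- The historical `chae_wolf_dss_existence` from the same trust base. [cite: BradshawTsai2019, Thm 1.2] -/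
theorem chae_wolf_dss_existence_of_prop_3_1_compactness (h41 : bradshawTsai2019_lemma_4_1)
    (h31 : bradshawTsai2019_prop_3_1) (hC : bradshawTsai2019_cylinderCompactness) :
    chae_wolf_dss_existence :=
  chae_wolf_dss_existence_of_bradshawTsai2019
    (bradshawTsai2019_dss_existence_of_prop_3_1_compactness h41 h31 hC)

end Literature.Analysis.FluidPDE

end
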